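import Literature.Geometry.Riemannian.LinearHeatVeryWeakNoncompact
import Literature.Geometry.Riemannian.LinearHeatWeakRegularityNoncompact
import Literature.Geometry.Riemannian.WeightedHeatCutoffCalculus
import Literature.Geometry.Riemannian.LinearHeatForcedExistence
import Literature.Geometry.Riemannian.LinearHeatBorel
import Literature.Geometry.Lorentzian.HessianLinear
import HarnessLib

/-!
# The linear heat Cauchy problem with compactly supported datum on a complete (non-compact) manifold

Topic `Geometry/Riemannian`; the non-compact, static-metric companion of `LinearHeatForcedExistence.lean` /
`LinearHeatCauchyExistence.lean` (closed manifolds). Setting: `(M, g)` Riemannian, modelled on `ℝⁿ`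
(Hausdorff, second countable, `T₃` — NOT compact), Laplacian cut-offs `η_k` (`IsLaplacianCutoff g η C`:
`|Δη_k| ≤ C`, eventually `1` near every point), a potential `Q ≥ 1` smooth on `M × ℝ`.

* `linearHeat_classical_of_isVeryWeakHeatSol` — a SMOOTH very weak solution (`IsVeryWeakHeatSol`) of
  `∂ₛv − Δ_g v + Qv = G` on `M × T` is a classical one (integration by parts in time, Green's identity with
  a compactly supported factor in space, Fubini for the σ-finite `V_g`, fundamental lemma of the calculus
  of variations on `M × ℝ`);
* `integral_sq_cutoff_le`, `energyVanishing_of_isLaplacianCutoff` — **energy uniqueness** for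
  `∂ₛw = Δw − Qw`, `Q ≥ 0`: a smooth solution with `w(·, a) = 0` and `∫∫ w² < ∞` vanishes on `M × [a, b]`
  (`∫ w(·,s)² η_k ≤ ∫∫ w² |Δη_k| → 0`);
* `exists_contMDiff_forall_iteratedDeriv_eq_of_isCompact`, `exists_flatCorrector_of_hasCompactSupport` —
  Borel summation of the formal power-series solution for a COMPACTLY SUPPORTED datum `w₀`: `W`, `G`
  smooth on `M × ℝ`, `W(0) = w₀`, supported in `K × (−∞, 1]`, `G = 0` for `s ≤ 0`,
  `G = −(∂ₛW − ΔW + QW)` for `s ≥ 0`;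
* `exists_smooth_linearHeat_forcing_static` — the forced problem with forcing supported in `s ≥ 0`: Lions'
  very weak solution (`exists_isVeryWeakHeatSol_static`), Hörmander's hypoellipticity
  (`exists_contMDiffOn_ae_eq_of_staticLinearHeat_veryWeak`), classical on `M × (−∞, b)`, `= 0` for
  `s ≤ 0` by energy uniqueness;
* `exists_linearHeat_forcedData_noncompact`, **`exists_linearHeat_cauchy_noncompact`** — for every
  `T > 0` a solution `w` of `∂ₛw = Δw − Qw`, `w(0) = w₀ ∈ C_c^∞`, smooth on `M × O` (`O ⊇ [0, T]` open),
  square integrable on `M × (0, T)`.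

This is the Literature home of the Summits-side
`EntropyRungNoncompactShrinkerGapHeat{ClassicalNoncompact,EnergyVanishing,FlatCorrector,LinearHeat}` (route
SmoothPoincare4/EntropyRung; not importable from Literature, CONVENTIONS §2). Everything is proved; no named
facts, no definitions.

## References

* F. Trèves, *Basic Linear Partial Differential Equations*, Academic Press 1975, §41, Thm. 40.1,
  Lemma 41.2, (41.19)–(41.21). [Treves1975]
* L. Hörmander, Acta Math. 119 (1967), Thm 1.1; *ALPDO I*, Thm. 1.2.6 (Borel). [Hormander1967]
* L. C. Evans, *Partial differential equations*, 2nd ed. (2010), §7.1.1. [Evans2010]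
* A. Grigor'yan, *Heat kernel and analysis on manifolds* (2009), Ch. 8, §11.4. [Grigoryan2009]
* J. A. Carrillo, L. Ni, Comm. Anal. Geom. 17 (2009), §4. [CarrilloNi2009]
-/

noncomputable section

open Set Function Filter MeasureTheory Bundle
open scoped Manifold ContDiff ENNReal NNReal Topology

namespace Literature.Geometry.Riemannian

open Lorentzian Lorentzian.PseudoRiemannianMetric Literature.Analysis.Calculus

section ClassicalStatic

variable {n : ℕ} {M : Type*} [TopologicalSpace M] [T2Space M] [SecondCountableTopology M]
  [ChartedSpace (EuclideanSpace ℝ (Fin n)) M] [IsManifold (𝓡 n) ∞ M] [T3Space M] [MeasurableSpace M]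
  [BorelSpace M]
  {g : PseudoRiemannianMetric (𝓡 n) ∞ (EuclideanSpace ℝ (Fin n)) (TangentSpace (𝓡 n) : M → Type _)}

omit [SecondCountableTopology M] [ChartedSpace (EuclideanSpace ℝ (Fin n)) M] [IsManifold (𝓡 n) ∞ M]
  [T3Space M] [MeasurableSpace M] [BorelSpace M] [T2Space M] in
/-- A function continuous on an open set times a continuous function supported inside that set is
continuous on the whole space. [folklore] -/
private theorem continuous_mul_of_continuousOn_of_tsupport_subset_cs {X : Type*} [TopologicalSpace X]
    {O : Set X} (hO : IsOpen O) {E k : X → ℝ} (hE : ContinuousOn E O) (hk : Continuous k)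
    (hkO : tsupport k ⊆ O) : Continuous fun p ↦ E p * k p := by
  refine continuous_of_tsupport fun p hp ↦ ?_
  have hpO : p ∈ O := hkO (tsupport_mul_subset_right hp)
  exact ((hE.continuousWithinAt hpO).continuousAt (hO.mem_nhds hpO)).mul hk.continuousAt

omit [SecondCountableTopology M] [ChartedSpace (EuclideanSpace ℝ (Fin n)) M] [IsManifold (𝓡 n) ∞ M]
  [T3Space M] [MeasurableSpace M] [BorelSpace M] in
/-- The space slice at time `σ` of a compactly supported function on `M × ℝ` has compact support
(Hausdorff `M`). [folklore] -/
theorem hasCompactSupport_slice_space_cs {k : M × ℝ → ℝ} (hkc : HasCompactSupport k) (σ : ℝ) :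
    HasCompactSupport fun x ↦ k (x, σ) :=
  HasCompactSupport.of_support_subset_isCompact (hkc.isCompact.image continuous_fst)
    fun x hx ↦ ⟨(x, σ), subset_tsupport _ hx, rfl⟩

/-- **Green's identity for the Laplace–Beltrami operator with one compactly supported factor, on a
(non-compact) Riemannian manifold modelled on `ℝⁿ`**: `∫ u Δ_g w dV_g = ∫ w Δ_g u dV_g` for
`u ∈ C²(M)`, `w ∈ C²_c(M)` (both sides equal `−∫ g⁻¹(du, dw) dV_g`, by
`integral_mul_dalembertian_eq_neg_integral_innerDual_of_hasCompactSupport` and its `_right` version).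
[cite: Lee2018, Problem 2-23 (a)] -/
theorem integral_mul_laplaceBeltrami_comm_of_hasCompactSupport_cs (hg : g.IsRiemannian) {u w : M → ℝ}
    (hu : ContMDiff (𝓡 n) 𝓘(ℝ, ℝ) 2 u) (hw : ContMDiff (𝓡 n) 𝓘(ℝ, ℝ) 2 w) (hwc : HasCompactSupport w) :
    ∫ x, u x * g.laplaceBeltrami w x ∂g.riemVolume = ∫ x, w x * g.laplaceBeltrami u x ∂g.riemVolume := by
  haveI : LocallyCompactSpace M := ChartedSpace.locallyCompactSpace (EuclideanSpace ℝ (Fin n)) M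
  haveI := g.hasLeviCivita
  haveI := (PseudoRiemannianMetric.ofRiemannian (g.toContMDiffRiemannianMetric hg)).hasLeviCivita
  have h1le : (1 : ℕ∞ω) ≤ (2 : ℕ∞ω) := by norm_cast
  have h1 := integral_mul_dalembertian_eq_neg_integral_innerDual_of_hasCompactSupport_right
    (g.toContMDiffRiemannianMetric hg) (hu.of_le h1le) hw hwc
  have h2 := integral_mul_dalembertian_eq_neg_integral_innerDual_of_hasCompactSupport
    (g.toContMDiffRiemannianMetric hg) (hw.of_le h1le) hwc hu
  simp only [PseudoRiemannianMetric.laplaceBeltrami_eq_dalembertian]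
  rw [PseudoRiemannianMetric.riemVolume_eq hg]
  refine h1.trans (Eq.trans ?_ h2.symm)
  congr 1
  exact integral_congr_ae (Eventually.of_forall fun x ↦ PseudoRiemannianMetric.innerDual_comm _ x _ _)

/-- **Smooth very weak solutions of `∂ₛv − Δ_g v + Q v = G` on a complete manifold are classical
solutions** (`IsVeryWeakHeatSol` + smooth ⇒ pointwise). `(M, g)` Riemannian modelled on `ℝⁿ` (Hausdorff, second countable, `T₃`, NOT compact), `Q, G`
smooth on `M × ℝ`, `T` open, `v` smooth on `M × T` with
`∫ v (−∂ₛζ − Δ_g ζ(·, s) + Qζ) d(V_g ⊗ ds) = ∫ G ζ d(V_g ⊗ ds)` for all smooth compactly supported `ζ`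
with `tsupport ζ ⊆ M × T`; then `∂ₛv − Δ_g v(·, s) + Qv = G` on `M × T` (integration by parts in time,
Green's identity with a compactly supported factor in space, Fubini for the σ-finite `V_g`, and the
fundamental lemma of the calculus of variations). [cite: Evans2010, §7.1.1] -/
theorem linearHeat_classical_of_isVeryWeakHeatSol (hg : g.IsRiemannian) {Q G : ℝ → M → ℝ}
    (hQ : ContMDiff ((𝓡 n).prod 𝓘(ℝ, ℝ)) 𝓘(ℝ, ℝ) ∞ fun p : M × ℝ ↦ Q p.2 p.1)
    (hG : ContMDiff ((𝓡 n).prod 𝓘(ℝ, ℝ)) 𝓘(ℝ, ℝ) ∞ fun p : M × ℝ ↦ G p.2 p.1)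
    {T : Set ℝ} (hT : IsOpen T) {v : M × ℝ → ℝ}
    (hv : ContMDiffOn ((𝓡 n).prod 𝓘(ℝ, ℝ)) 𝓘(ℝ, ℝ) ∞ v (univ ×ˢ T))
    (hvw : IsVeryWeakHeatSol g Q G T v) :
    ∀ p ∈ univ ×ˢ T, deriv (fun s ↦ v (p.1, s)) p.2 -
      g.laplaceBeltrami (fun x ↦ v (x, p.2)) p.1 + Q p.2 p.1 * v p = G p.2 p.1 := by
  classical
  have h1le : (1 : ℕ∞ω) ≤ (∞ : ℕ∞ω) := WithTop.coe_le_coe.mpr le_top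
  have h2le : (2 : ℕ∞ω) ≤ (∞ : ℕ∞ω) := WithTop.coe_le_coe.mpr le_top
  -- topology and the reference measure (finite on compact sets, σ-finite, positive on open sets)
  haveI : LocallyCompactSpace M := ChartedSpace.locallyCompactSpace (EuclideanSpace ℝ (Fin n)) M
  set μ₀ : Measure M := g.riemVolume with hμ₀
  haveI : IsFiniteMeasureOnCompacts μ₀ := CarrilloNi2009_shrinkerLSI.isFiniteMeasureOnCompacts_riemVolume hg
  haveI : μ₀.IsOpenPosMeasure := by
    rw [hμ₀, PseudoRiemannianMetric.riemVolume_eq hg]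
    exact isOpenPosMeasure_riemannianMeasure _
  haveI : (μ₀.prod (volume : Measure ℝ)).IsOpenPosMeasure := Measure.prod.instIsOpenPosMeasure
  have hO : IsOpen ((univ : Set M) ×ˢ T) := isOpen_univ.prod hT
  have hfam : IsContMDiffFamilyOn ∞ (fun _ : ℝ ↦ g) univ := isContMDiffFamilyOn_const g univ
  -- continuity data of `v`: `v`, `∂ₛv`, `Δv` on `M × T`; slices
  have hvc : ContinuousOn v (univ ×ˢ T) := hv.continuousOn
  have hDv : ContinuousOn (fun p : M × ℝ ↦ deriv (fun s ↦ v (p.1, s)) p.2) (univ ×ˢ T) := by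
    have h1 := Literature.Geometry.Manifold.contMDiffOn_derivWithin_time (I := 𝓡 n)
      (u := fun s x ↦ v (x, s)) hT.uniqueDiffOn hv
    refine h1.continuousOn.congr fun p hp ↦ ?_
    simp only
    rw [derivWithin_of_isOpen hT hp.2]
  have hLv : ContinuousOn (fun p : M × ℝ ↦ g.laplaceBeltrami (fun x ↦ v (x, p.2)) p.1) (univ ×ˢ T) :=
    ((hfam.mono (subset_univ T)).contMDiffOn_laplaceBeltrami hT.uniqueDiffOn
      (f := fun s x ↦ v (x, s)) hv).continuousOn
  have hvslice : ∀ σ ∈ T, ContMDiff (𝓡 n) 𝓘(ℝ, ℝ) ∞ fun x ↦ v (x, σ) := fun σ hσ ↦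
    hv.comp_contMDiff (contMDiff_id.prodMk contMDiff_const) fun x ↦ ⟨mem_univ _, hσ⟩
  have hvderiv : ∀ y, ∀ σ ∈ T, HasDerivAt (fun s ↦ v (y, s)) (deriv (fun s ↦ v (y, s)) σ) σ := by
    intro y σ hσ
    have h1 : ContMDiffAt ((𝓡 n).prod 𝓘(ℝ, ℝ)) 𝓘(ℝ, ℝ) ∞ v (y, σ) :=
      (hv _ ⟨mem_univ _, hσ⟩).contMDiffAt (hO.mem_nhds ⟨mem_univ _, hσ⟩)
    have h2 : ContMDiffAt 𝓘(ℝ, ℝ) 𝓘(ℝ, ℝ) ∞ (fun s ↦ v (y, s)) σ :=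
      h1.comp σ (contMDiffAt_const.prodMk contMDiffAt_id)
    exact (h2.contDiffAt.differentiableAt (by simp)).hasDerivAt
  -- the continuous function which will be shown to vanish
  set W : M × ℝ → ℝ := fun p ↦ deriv (fun s ↦ v (p.1, s)) p.2 -
    g.laplaceBeltrami (fun x ↦ v (x, p.2)) p.1 + Q p.2 p.1 * v p - G p.2 p.1 with hW
  have hWc : ContinuousOn W (univ ×ˢ T) :=
    ((hDv.sub hLv).add (hQ.continuous.continuousOn.mul hvc)).sub hG.continuous.continuousOn
  suffices hW0 : ∀ p ∈ univ ×ˢ T, W p = 0 by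
    intro p hp
    have h1 := hW0 p hp
    rw [hW] at h1
    simp only at h1
    linarith
  refine eqOn_zero_of_forall_integral_mul_contMDiff_eq_zero (J := (𝓡 n).prod 𝓘(ℝ, ℝ))
    (μ₀.prod (volume : Measure ℝ)) hO hWc fun ζ hζ hζc hζT _ ↦ ?_
  /- the identity `∫ W ζ = 0` for a test function `ζ` -/
  have hζc' : Continuous ζ := hζ.continuous
  have hζslice : ∀ σ, ContMDiff (𝓡 n) 𝓘(ℝ, ℝ) ∞ fun x ↦ ζ (x, σ) := fun σ ↦
    hζ.comp (contMDiff_id.prodMk contMDiff_const)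
  have hζzero : ∀ p, p ∉ tsupport ζ → ζ =ᶠ[𝓝 p] 0 := fun p hp ↦
    notMem_tsupport_iff_eventuallyEq.1 hp
  have hζT' : ∀ σ, σ ∉ T → ∀ y, ζ (y, σ) = 0 := fun σ hσ y ↦
    image_eq_zero_of_notMem_tsupport fun hm ↦ hσ (hζT hm).2
  -- the time derivative `kt` and the space term `kx`
  set kt : M × ℝ → ℝ := fun p ↦ deriv (fun s ↦ ζ (p.1, s)) p.2 with hkt
  have hktc : Continuous kt := (contMDiff_deriv_time hζ).continuous
  have hktsupp : Function.support kt ⊆ tsupport ζ := by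
    intro p hp
    by_contra hnot
    have e0 : (fun s ↦ ζ (p.1, s)) =ᶠ[𝓝 p.2] fun _ ↦ (0 : ℝ) := by
      have e1 := eventuallyEq_zero_comp_of_eventuallyEq_zero (ι := fun s : ℝ ↦ ((p.1, s) : M × ℝ))
        (continuous_const.prodMk continuous_id) (y := p.2) (hζzero p hnot)
      filter_upwards [e1] with s hs
      simpa only [Pi.zero_apply] using hs
    refine hp ?_
    rw [hkt]
    simp only
    rw [e0.deriv_eq]
    exact deriv_const p.2 0
  have hktT : tsupport kt ⊆ univ ×ˢ T :=
    (closure_minimal hktsupp (isClosed_tsupport ζ)).trans hζT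
  have hktcs : HasCompactSupport kt := hζc.mono' hktsupp
  set kx : M × ℝ → ℝ := fun p ↦ g.laplaceBeltrami (fun x ↦ ζ (x, p.2)) p.1 with hkx
  have hkxc : Continuous kx := (contMDiff_laplaceBeltrami_family hfam hζ).continuous
  have hkxsupp : Function.support kx ⊆ tsupport ζ := by
    intro p hp
    by_contra hnot
    have e0 : (fun x ↦ ζ (x, p.2)) =ᶠ[𝓝 p.1] fun _ ↦ (0 : ℝ) :=
      eventuallyEq_zero_comp_of_eventuallyEq_zero (ι := fun x : M ↦ ((x, p.2) : M × ℝ))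
        (continuous_id.prodMk continuous_const) (y := p.1) (hζzero p hnot)
    refine hp ?_
    rw [hkx]
    simp only
    rw [laplaceBeltrami_eq_zero_of_eventuallyEq_zero _ e0]
  have hkxT : tsupport kx ⊆ univ ×ˢ T :=
    (closure_minimal hkxsupp (isClosed_tsupport ζ)).trans hζT
  have hkxcs : HasCompactSupport kx := hζc.mono' hkxsupp
  -- integrability of the space-time integrands
  have hI1 : Integrable (fun p ↦ v p * kt p) (μ₀.prod (volume : Measure ℝ)) :=
    (continuous_mul_of_continuousOn_of_tsupport_subset_cs hO hvc hktc hktT)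
      |>.integrable_of_hasCompactSupport hktcs.mul_left
  have hI2 : Integrable (fun p : M × ℝ ↦ deriv (fun s ↦ v (p.1, s)) p.2 * ζ p)
      (μ₀.prod (volume : Measure ℝ)) :=
    (continuous_mul_of_continuousOn_of_tsupport_subset_cs hO hDv hζc' hζT)
      |>.integrable_of_hasCompactSupport hζc.mul_left
  have hI3 : Integrable (fun p ↦ v p * kx p) (μ₀.prod (volume : Measure ℝ)) :=
    (continuous_mul_of_continuousOn_of_tsupport_subset_cs hO hvc hkxc hkxT)
      |>.integrable_of_hasCompactSupport hkxcs.mul_left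
  have hI4 : Integrable (fun p : M × ℝ ↦ g.laplaceBeltrami (fun x ↦ v (x, p.2)) p.1 * ζ p)
      (μ₀.prod (volume : Measure ℝ)) :=
    (continuous_mul_of_continuousOn_of_tsupport_subset_cs hO hLv hζc' hζT)
      |>.integrable_of_hasCompactSupport hζc.mul_left
  have hI5 : Integrable (fun p : M × ℝ ↦ v p * (Q p.2 p.1 * ζ p)) (μ₀.prod (volume : Measure ℝ)) := by
    have hs : tsupport (fun p : M × ℝ ↦ Q p.2 p.1 * ζ p) ⊆ univ ×ˢ T :=
      (tsupport_mul_subset_right).trans hζT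
    exact (continuous_mul_of_continuousOn_of_tsupport_subset_cs hO hvc (hQ.continuous.mul hζc')
      hs).integrable_of_hasCompactSupport hζc.mul_left.mul_left
  have hI6 : Integrable (fun p : M × ℝ ↦ G p.2 p.1 * ζ p) (μ₀.prod (volume : Measure ℝ)) :=
    (hG.continuous.mul hζc').integrable_of_hasCompactSupport hζc.mul_left
  -- (I-t) integration by parts in time
  have hIt : ∫ p, v p * kt p ∂μ₀.prod (volume : Measure ℝ) =
      -∫ p : M × ℝ, deriv (fun s ↦ v (p.1, s)) p.2 * ζ p ∂μ₀.prod (volume : Measure ℝ) := by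
    rw [integral_prod _ hI1, integral_prod _ hI2, ← integral_neg]
    refine integral_congr_ae (Eventually.of_forall fun y ↦ ?_)
    simp only
    obtain ⟨hkyc, hkyT⟩ := hasCompactSupport_slice_time hζc y hζT
    have hky : ContDiff ℝ 1 fun s ↦ ζ (y, s) := (contDiff_slice_time hζ y).of_le h1le
    have hwc : ContinuousOn (fun s ↦ v (y, s)) T :=
      hvc.comp (continuous_const.prodMk continuous_id).continuousOn fun s hs ↦ ⟨mem_univ _, hs⟩
    have hw'c : ContinuousOn (fun s ↦ deriv (fun s' ↦ v (y, s')) s) T :=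
      hDv.comp (continuous_const.prodMk continuous_id).continuousOn fun s hs ↦ ⟨mem_univ _, hs⟩
    exact integral_mul_deriv_eq_neg_of_tsupport_subset hT hwc hw'c (hvderiv y) hky hkyc hkyT
  -- (I-x) Green's identity in space (one factor compactly supported)
  have hIx : ∫ p, v p * kx p ∂μ₀.prod (volume : Measure ℝ) =
      ∫ p : M × ℝ, g.laplaceBeltrami (fun x ↦ v (x, p.2)) p.1 * ζ p ∂μ₀.prod (volume : Measure ℝ) := by
    rw [integral_prod_symm _ hI3, integral_prod_symm _ hI4]
    refine integral_congr_ae (Eventually.of_forall fun σ ↦ ?_)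
    simp only
    by_cases hσ : σ ∈ T
    · have hcomm := integral_mul_laplaceBeltrami_comm_of_hasCompactSupport_cs hg
        ((hvslice σ hσ).of_le h2le) ((hζslice σ).of_le h2le) (hasCompactSupport_slice_space_cs hζc σ)
      rw [hkx]
      refine hcomm.trans (integral_congr_ae (Eventually.of_forall fun y ↦ ?_))
      simp only
      ring
    · have hz : (fun x ↦ ζ (x, σ)) = fun _ ↦ (0 : ℝ) := funext fun y ↦ hζT' σ hσ y
      refine integral_congr_ae (Eventually.of_forall fun y ↦ ?_)
      rw [hkx]
      simp only
      rw [hz, laplaceBeltrami_fun_zero, hζT' σ hσ y]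
      ring
  -- assemble
  have hw := hvw.integral_eq ζ hζ hζc hζT
  have hlhs : ∫ p, v p * (-(deriv (fun s ↦ ζ (p.1, s)) p.2) -
      g.laplaceBeltrami (fun x ↦ ζ (x, p.2)) p.1 + Q p.2 p.1 * ζ p) ∂μ₀.prod (volume : Measure ℝ) =
      -∫ p, v p * kt p ∂μ₀.prod (volume : Measure ℝ) - ∫ p, v p * kx p ∂μ₀.prod (volume : Measure ℝ)
        + ∫ p : M × ℝ, v p * (Q p.2 p.1 * ζ p) ∂μ₀.prod (volume : Measure ℝ) := by
    have e1 : ∫ p, v p * (-(deriv (fun s ↦ ζ (p.1, s)) p.2) -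
        g.laplaceBeltrami (fun x ↦ ζ (x, p.2)) p.1 + Q p.2 p.1 * ζ p) ∂μ₀.prod (volume : Measure ℝ) =
        ∫ p : M × ℝ, ((-(v p * kt p) - v p * kx p) + v p * (Q p.2 p.1 * ζ p))
          ∂μ₀.prod (volume : Measure ℝ) := by
      refine integral_congr_ae (Eventually.of_forall fun p ↦ ?_)
      rw [hkt, hkx]
      simp only
      ring
    have hA : Integrable (fun p : M × ℝ ↦ -(v p * kt p) - v p * kx p)
        (μ₀.prod (volume : Measure ℝ)) := hI1.fun_neg.sub hI3
    have hB : Integrable (fun p : M × ℝ ↦ -(v p * kt p)) (μ₀.prod (volume : Measure ℝ)) :=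
      hI1.fun_neg
    rw [e1, integral_add hA hI5, integral_sub hB hI3, integral_neg]
  rw [hlhs, hIt, hIx, neg_neg] at hw
  -- `∫ W ζ = (∫ ∂v ζ) - (∫ Δv ζ) + (∫ v Q ζ) - ∫ G ζ = 0`
  have hWζ : ∫ p, W p * ζ p ∂μ₀.prod (volume : Measure ℝ) =
      ∫ p : M × ℝ, deriv (fun s ↦ v (p.1, s)) p.2 * ζ p ∂μ₀.prod (volume : Measure ℝ)
      - ∫ p : M × ℝ, g.laplaceBeltrami (fun x ↦ v (x, p.2)) p.1 * ζ p ∂μ₀.prod (volume : Measure ℝ)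
      + ∫ p : M × ℝ, v p * (Q p.2 p.1 * ζ p) ∂μ₀.prod (volume : Measure ℝ)
      - ∫ p : M × ℝ, G p.2 p.1 * ζ p ∂μ₀.prod (volume : Measure ℝ) := by
    have e2 : ∫ p, W p * ζ p ∂μ₀.prod (volume : Measure ℝ) =
        ∫ p : M × ℝ, (((deriv (fun s ↦ v (p.1, s)) p.2 * ζ p
          - g.laplaceBeltrami (fun x ↦ v (x, p.2)) p.1 * ζ p)
          + v p * (Q p.2 p.1 * ζ p)) - G p.2 p.1 * ζ p) ∂μ₀.prod (volume : Measure ℝ) := by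
      refine integral_congr_ae (Eventually.of_forall fun p ↦ ?_)
      rw [hW]
      simp only
      ring
    have hA : Integrable (fun p : M × ℝ ↦ deriv (fun s ↦ v (p.1, s)) p.2 * ζ p
        - g.laplaceBeltrami (fun x ↦ v (x, p.2)) p.1 * ζ p) (μ₀.prod (volume : Measure ℝ)) :=
      hI2.sub hI4
    have hB : Integrable (fun p : M × ℝ ↦ (deriv (fun s ↦ v (p.1, s)) p.2 * ζ p
        - g.laplaceBeltrami (fun x ↦ v (x, p.2)) p.1 * ζ p) + v p * (Q p.2 p.1 * ζ p))
        (μ₀.prod (volume : Measure ℝ)) := hA.add hI5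
    rw [e2, integral_sub hB hI6, integral_add hA hI5, integral_sub hI2 hI4]
  rw [hWζ]
  linarith [hw]

end ClassicalStatic

/-! ### Energy uniqueness with Laplacian cut-offs -/

section Vanishing

variable {n : ℕ} {M : Type*} [TopologicalSpace M] [T2Space M] [SecondCountableTopology M]
  [ChartedSpace (EuclideanSpace ℝ (Fin n)) M] [IsManifold (𝓡 n) ∞ M] [T3Space M]
  [MeasurableSpace M] [BorelSpace M]
  {g : PseudoRiemannianMetric (𝓡 n) ∞ (EuclideanSpace ℝ (Fin n)) (TangentSpace (𝓡 n) : M → Type _)}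
  [g.HasLeviCivita]

/-- **`∫ u η Δu ≤ ½ ∫ u² |Δη|`** for `u` smooth and a smooth compactly supported `η ≥ 0`: the
energy identity with a cut-off (`V = 0`) reads `∫ u η Δu = −∫ η|∇u|² + ½ ∫ u² Δη`.
[cite: CarrilloNi2009, §4 (integration by parts on the complete soliton)] -/
theorem integral_mul_cutoff_mul_dalembertian_le (hg : g.IsRiemannian) {u η : M → ℝ}
    (hu : ContMDiff (𝓡 n) 𝓘(ℝ, ℝ) ∞ u) (hη : ContMDiff (𝓡 n) 𝓘(ℝ, ℝ) ∞ η)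
    (hηc : HasCompactSupport η) (hη0 : ∀ x, 0 ≤ η x) :
    ∫ x, u x * η x * g.dalembertian u x ∂g.riemVolume ≤
      1 / 2 * ∫ x, u x ^ 2 * |g.dalembertian η x| ∂g.riemVolume := by
  haveI := CarrilloNi2009_shrinkerLSI.isFiniteMeasureOnCompacts_riemVolume hg
  have h2 : (2 : ℕ∞ω) ≤ (∞ : ℕ∞ω) := WithTop.coe_le_coe.mpr le_top
  have hid := integral_sub_mul_cutoff_mul_weightedLaplacian hg hu hη hηc
    (contMDiff_const (c := (0 : ℝ))) 0
  simp only [sub_zero, mvfderiv_const, ContinuousLinearMap.toLinearMap_zero, neg_zero,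
    Real.exp_zero, mul_one] at hid
  have h0 : ∀ (x : M) (β : Module.Dual ℝ (TangentSpace (𝓡 n) x)), g.innerDual x 0 β = 0 :=
    fun x β ↦ by simp [PseudoRiemannianMetric.innerDual]
  simp only [h0, sub_zero] at hid
  rw [hid]
  have hG : 0 ≤ ∫ x, η x * g.gradSq u x ∂g.riemVolume :=
    integral_nonneg fun x ↦ mul_nonneg (hη0 x) (g.gradSq_nonneg hg _ _)
  have hΔc : HasCompactSupport (g.dalembertian η) :=
    HasCompactSupport.intro hηc fun x hx ↦ g.dalembertian_eq_zero_of_notMem_tsupport hx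
  have hR : ∫ x, u x ^ 2 * g.dalembertian η x ∂g.riemVolume ≤
      ∫ x, u x ^ 2 * |g.dalembertian η x| ∂g.riemVolume := by
    refine integral_mono ?_ ?_ fun x ↦ ?_
    · exact ((hu.continuous.pow 2).mul (continuous_dalembertian g (hη.of_le h2))).integrable_of_hasCompactSupport
        hΔc.mul_left
    · exact ((hu.continuous.pow 2).mul
        (continuous_abs.comp (continuous_dalembertian g (hη.of_le h2)))).integrable_of_hasCompactSupport
        hΔc.abs.mul_left
    · exact mul_le_mul_of_nonneg_left (le_abs_self _) (sq_nonneg _)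
  linarith

/-- **One cut-off: `∫ w(·, s)² η ≤ ∫∫_{M×(a,b)} w² |Δη|`.** For `w` smooth on `M × O`
(`O ⊇ [a, b]` open) with `∂ₛw = Δw − Qw` on `[a, b]`, `Q ≥ 0`, `w(·, a) = 0`, and a smooth
compactly supported `η ≥ 0`: `E(s) = ∫ w(·,s)² η` has `E(a) = 0` and
`E' = 2∫ w η ∂ₛw ≤ 2∫ w η Δw ≤ ∫ w² |Δη|` on `[a, b]` (Leibniz rule,
`integral_mul_cutoff_mul_dalembertian_le`), so `E(s) ≤ ∫ₐᵇ∫ w² |Δη|` (FTC, Fubini).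
[cite: CarrilloNi2009, §4 (integration by parts on the complete soliton)] -/
theorem integral_sq_cutoff_le (hg : g.IsRiemannian) {η : M → ℝ} (hη : ContMDiff (𝓡 n) 𝓘(ℝ, ℝ) ∞ η)
    (hηc : HasCompactSupport η) (hη0 : ∀ x, 0 ≤ η x) {Q : ℝ → M → ℝ} {a b : ℝ} {O : Set ℝ}
    {w : M × ℝ → ℝ} (hO : IsOpen O) (habO : Icc a b ⊆ O) (hQ : ∀ s ∈ Icc a b, ∀ x, 0 ≤ Q s x)
    (hw : ContMDiffOn ((𝓡 n).prod 𝓘(ℝ, ℝ)) 𝓘(ℝ, ℝ) ∞ w (univ ×ˢ O))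
    (heq : ∀ s ∈ Icc a b, ∀ x, deriv (fun r ↦ w (x, r)) s =
      g.dalembertian (fun y ↦ w (y, s)) x - Q s x * w (x, s))
    (hwa : ∀ x, w (x, a) = 0) {s : ℝ} (hs : s ∈ Icc a b) :
    ∫ x, w (x, s) ^ 2 * η x ∂g.riemVolume ≤
      ∫ p, w p ^ 2 * |g.dalembertian η p.1|
        ∂(g.riemVolume.prod (volume : Measure ℝ)).restrict (univ ×ˢ Ioo a b) := by
  haveI := CarrilloNi2009_shrinkerLSI.isFiniteMeasureOnCompacts_riemVolume hg
  haveI := sigmaFinite_riemVolume hg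
  have h2 : (2 : ℕ∞ω) ≤ (∞ : ℕ∞ω) := WithTop.coe_le_coe.mpr le_top
  have hab : a ≤ b := le_trans hs.1 hs.2
  set μ : Measure M := g.riemVolume with hμ
  -- `w` as a family `ρ r x = w (x, r)`
  set ρ : ℝ → M → ℝ := fun r x ↦ w (x, r) with hρdef
  have hρ : ContMDiffOn ((𝓡 n).prod 𝓘(ℝ, ℝ)) 𝓘(ℝ, ℝ) ∞ (fun p : M × ℝ ↦ ρ p.2 p.1) (univ ×ˢ O) :=
    hw
  have hslice : ∀ r ∈ O, ContMDiff (𝓡 n) 𝓘(ℝ, ℝ) ∞ (ρ r) := fun r hr ↦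
    contMDiff_slice_of_contMDiffOn hρ hr
  have hρc : ContinuousOn (fun p : M × ℝ ↦ ρ p.2 p.1) (univ ×ˢ O) := hρ.continuousOn
  have hρ'c : ContinuousOn (fun p : M × ℝ ↦ deriv (fun r ↦ ρ r p.1) p.2) (univ ×ˢ O) :=
    continuousOn_deriv_time_of_contMDiffOn hO hρ
  have hF : ContinuousOn (fun p : M × ℝ ↦ ρ p.2 p.1 ^ 2) (univ ×ˢ O) := hρc.pow 2
  have hF' : ContinuousOn (fun p : M × ℝ ↦ 2 * ρ p.2 p.1 * deriv (fun r ↦ ρ r p.1) p.2)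
      (univ ×ˢ O) := (continuousOn_const.mul hρc).mul hρ'c
  have hd : ∀ r ∈ O, ∀ x, HasDerivAt (fun r' ↦ ρ r' x ^ 2)
      (2 * ρ r x * deriv (fun r' ↦ ρ r' x) r) r := by
    intro r hr x
    have h := (hasDerivAt_time_of_contMDiffOn hO hρ x hr).pow 2
    refine h.congr_deriv ?_
    norm_num
  -- the weights `η` and `|Δη|`
  have hΔc : Continuous (g.dalembertian η) := continuous_dalembertian g (hη.of_le h2)
  have hΔs : HasCompactSupport (g.dalembertian η) :=
    HasCompactSupport.intro hηc fun x hx ↦ g.dalembertian_eq_zero_of_notMem_tsupport hx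
  have hAc : Continuous fun x ↦ |g.dalembertian η x| := continuous_abs.comp hΔc
  have hAs : HasCompactSupport fun x ↦ |g.dalembertian η x| := hΔs.abs
  -- `E`, `E'`, `R⁺`
  set E : ℝ → ℝ := fun r ↦ ∫ x, ρ r x ^ 2 * η x ∂μ with hE
  set E' : ℝ → ℝ := fun r ↦ ∫ x, (2 * ρ r x * deriv (fun r' ↦ ρ r' x) r) * η x ∂μ with hE'
  set R : ℝ → ℝ := fun r ↦ ∫ x, ρ r x ^ 2 * |g.dalembertian η x| ∂μ with hR
  have hEd : ∀ r ∈ O, HasDerivAt E (E' r) r := fun r hr ↦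
    hasDerivAt_integral_mul_of_hasCompactSupport μ hη.continuous hηc hO hF hF' hd hr
  have hE'c : ContinuousOn E' O :=
    continuousOn_integral_mul_of_hasCompactSupport μ hη.continuous hηc hF'
  have hRc : ContinuousOn R O := continuousOn_integral_mul_of_hasCompactSupport μ hAc hAs hF
  -- `E' ≤ R` on `[a, b]`
  have hE'le : ∀ r ∈ Icc a b, E' r ≤ R r := by
    intro r hr
    have hrO := habO hr
    have hu := hslice r hrO
    -- pointwise `2 w ∂ₛw η ≤ 2 w η Δw` (the equation and `Q ≥ 0`, `η ≥ 0`)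
    have hpt : ∀ x, (2 * ρ r x * deriv (fun r' ↦ ρ r' x) r) * η x ≤
        2 * (ρ r x * η x * g.dalembertian (ρ r) x) := by
      intro x
      have he : deriv (fun r' ↦ ρ r' x) r = g.dalembertian (ρ r) x - Q r x * ρ r x := heq r hr x
      rw [he]
      nlinarith [hQ r hr x, hη0 x, sq_nonneg (ρ r x), mul_nonneg (mul_nonneg (hQ r hr x) (sq_nonneg (ρ r x))) (hη0 x)]
    have hi1 : Integrable (fun x ↦ (2 * ρ r x * deriv (fun r' ↦ ρ r' x) r) * η x) μ := by
      have hc : Continuous fun x ↦ deriv (fun r' ↦ ρ r' x) r :=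
        hρ'c.comp_continuous (f := fun x : M ↦ ((x, r) : M × ℝ)) (by fun_prop)
          fun x ↦ ⟨mem_univ _, hrO⟩
      exact (((continuous_const.mul hu.continuous).mul hc).mul hη.continuous).integrable_of_hasCompactSupport
        hηc.mul_left
    have hi2 : Integrable (fun x ↦ 2 * (ρ r x * η x * g.dalembertian (ρ r) x)) μ := by
      refine (continuous_const.mul ((hu.continuous.mul hη.continuous).mul
        (continuous_dalembertian g (hu.of_le h2)))).integrable_of_hasCompactSupport ?_
      exact (hηc.mul_left.mul_right).mul_left
    calc E' r ≤ ∫ x, 2 * (ρ r x * η x * g.dalembertian (ρ r) x) ∂μ := integral_mono hi1 hi2 hpt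
      _ = 2 * ∫ x, ρ r x * η x * g.dalembertian (ρ r) x ∂μ := integral_const_mul _ _
      _ ≤ 2 * (1 / 2 * ∫ x, ρ r x ^ 2 * |g.dalembertian η x| ∂μ) :=
          mul_le_mul_of_nonneg_left (integral_mul_cutoff_mul_dalembertian_le hg hu hη hηc hη0)
            (by norm_num)
      _ = R r := by ring
  -- FTC on `[a, s]`, monotonicity, and Fubini
  have hsO : Icc a s ⊆ O := (Icc_subset_Icc_right hs.2).trans habO
  have huIcc : uIcc a s = Icc a s := uIcc_of_le hs.1
  have hFTC : ∫ r in a..s, E' r = E s - E a :=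
    intervalIntegral.integral_eq_sub_of_hasDerivAt (fun r hr ↦ hEd r (hsO (huIcc ▸ hr)))
      ((hE'c.mono hsO).intervalIntegrable_of_Icc hs.1)
  have hEa : E a = 0 := by
    simp only [hE, hρdef, hwa]
    simp
  have hRi : IntervalIntegrable R volume a b := (hRc.mono habO).intervalIntegrable_of_Icc hab
  have hmono1 : ∫ r in a..s, E' r ≤ ∫ r in a..s, R r :=
    intervalIntegral.integral_mono_on hs.1 ((hE'c.mono hsO).intervalIntegrable_of_Icc hs.1)
      ((hRc.mono hsO).intervalIntegrable_of_Icc hs.1)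
      fun r hr ↦ hE'le r ⟨hr.1, hr.2.trans hs.2⟩
  have hR0 : ∀ r, 0 ≤ R r := fun r ↦
    integral_nonneg fun x ↦ mul_nonneg (sq_nonneg _) (abs_nonneg _)
  have hmono2 : ∫ r in a..s, R r ≤ ∫ r in a..b, R r :=
    intervalIntegral.integral_mono_interval le_rfl hs.1 hs.2
      (Eventually.of_forall fun r ↦ hR0 r) hRi
  have hFub : ∫ p, w p ^ 2 * |g.dalembertian η p.1|
      ∂(μ.prod (volume : Measure ℝ)).restrict (univ ×ˢ Ioo a b) = ∫ r in a..b, R r :=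
    integral_strip_eq_intervalIntegral μ hab
      (integrable_strip_mul_of_hasCompactSupport μ (F := fun p : M × ℝ ↦ w p ^ 2)
        (hF.mono (prod_mono le_rfl habO)) hAc hAs)
  have hEs : E s = ∫ x, w (x, s) ^ 2 * η x ∂μ := rfl
  rw [hFub, ← hEs]
  linarith

/-- **Energy uniqueness for `∂ₛw = Δw − Qw`, `Q ≥ 0`, on a complete manifold with Laplacian cut-offs**
(`IsLaplacianCutoff g η C`: `η_k ∈ C_c^∞`, `0 ≤ η_k ≤ 1`, `η_k ↑`, eventually `1` near every point,
`|Δη_k| ≤ C`): a smooth `w`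
on `M × O` (`O ⊇ [a, b]` open) with `∂ₛw = Δw − Qw` on `[a, b]`, `w(·, a) = 0` and
`∫∫_{M×(a,b)} w² < ∞` vanishes on `M × [a, b]`: `∫ w(·,s)² η_k ≤ ∫∫ w² |Δη_k| → 0`
(`integral_sq_cutoff_le`, dominated convergence), the left side is non-decreasing in `k`, hence
`0`, and a continuous nonnegative function with zero integral against a measure charging open
sets vanishes. [cite: CarrilloNi2009, §4 (integration by parts on the complete soliton)] -/
theorem energyVanishing_of_isLaplacianCutoff (hg : g.IsRiemannian) {η : ℕ → M → ℝ} {C : ℝ}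
    (hη : IsLaplacianCutoff g η C) {Q : ℝ → M → ℝ} {a b : ℝ} {O : Set ℝ} {w : M × ℝ → ℝ}
    (hO : IsOpen O) (habO : Icc a b ⊆ O) (hQ : ∀ s ∈ Icc a b, ∀ x, 0 ≤ Q s x)
    (hw : ContMDiffOn ((𝓡 n).prod 𝓘(ℝ, ℝ)) 𝓘(ℝ, ℝ) ∞ w (univ ×ˢ O))
    (heq : ∀ s ∈ Icc a b, ∀ x, deriv (fun r ↦ w (x, r)) s =
      g.dalembertian (fun y ↦ w (y, s)) x - Q s x * w (x, s))
    (hwa : ∀ x, w (x, a) = 0)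
    (hInt : Integrable (fun p : M × ℝ ↦ w p ^ 2)
      ((g.riemVolume.prod (volume : Measure ℝ)).restrict (univ ×ˢ Ioo a b)))
    {s : ℝ} (hs : s ∈ Icc a b) (x₀ : M) : w (x₀, s) = 0 := by
  obtain ⟨⟨hηs, hηc, hη01, hmono, hη1⟩, hΔη⟩ := hη
  haveI := CarrilloNi2009_shrinkerLSI.isFiniteMeasureOnCompacts_riemVolume hg
  haveI := sigmaFinite_riemVolume hg
  haveI := isOpenPosMeasure_riemVolume hg
  have h2 : (2 : ℕ∞ω) ≤ (∞ : ℕ∞ω) := WithTop.coe_le_coe.mpr le_top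
  set μ : Measure M := g.riemVolume with hμ
  set ν : Measure (M × ℝ) := (μ.prod (volume : Measure ℝ)).restrict (univ ×ˢ Ioo a b) with hν
  -- the slice `u = w(·, s)` is smooth
  have hu : ContMDiff (𝓡 n) 𝓘(ℝ, ℝ) ∞ fun y ↦ w (y, s) :=
    contMDiff_slice_of_contMDiffOn (u := fun r y ↦ w (y, r)) hw (habO hs)
  -- Step 1: `E_k(s) ≤ r_k = ∫∫ w² |Δη_k|`
  have hstep : ∀ k, ∫ x, w (x, s) ^ 2 * η k x ∂μ ≤ ∫ p, w p ^ 2 * |g.dalembertian (η k) p.1| ∂ν :=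
    fun k ↦ integral_sq_cutoff_le hg (hηs k) (hηc k) (fun x ↦ (hη01 k x).1) hO habO hQ hw heq hwa hs
  -- Step 2: `r_k → 0`
  have hwc : ContinuousOn (fun p : M × ℝ ↦ w p ^ 2) (univ ×ˢ Ioo a b) :=
    (hw.continuousOn.mono (prod_mono le_rfl (Ioo_subset_Icc_self.trans habO))).pow 2
  have hr_meas : ∀ k, AEStronglyMeasurable (fun p : M × ℝ ↦ w p ^ 2 * |g.dalembertian (η k) p.1|) ν :=
    fun k ↦ aestronglyMeasurable_strip μ (hwc.mul ((continuous_abs.comp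
      (continuous_dalembertian g ((hηs k).of_le h2))).comp continuous_fst).continuousOn)
  have hr_bd : ∀ k (p : M × ℝ), ‖w p ^ 2 * |g.dalembertian (η k) p.1|‖ ≤ C * w p ^ 2 := fun k p ↦ by
    rw [Real.norm_eq_abs, abs_mul, abs_abs, abs_of_nonneg (sq_nonneg _), mul_comm]
    exact mul_le_mul_of_nonneg_right (hΔη k p.1) (sq_nonneg _)
  have hr_t : Tendsto (fun k ↦ ∫ p, w p ^ 2 * |g.dalembertian (η k) p.1| ∂ν) atTop (𝓝 0) := by
    have hlim : ∀ p : M × ℝ, Tendsto (fun k ↦ w p ^ 2 * |g.dalembertian (η k) p.1|) atTop (𝓝 0) :=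
      fun p ↦ by
      refine tendsto_const_nhds.congr' ?_
      filter_upwards [IsCutoffExhaustion.dalembertian_eventually_eq_zero (g := g) ⟨hηs, hηc, hη01, hmono, hη1⟩ p.1] with k hk
      rw [hk, abs_zero, mul_zero]
    have h := tendsto_integral_of_dominated_convergence (fun p : M × ℝ ↦ C * w p ^ 2) hr_meas
      (hInt.const_mul C) (fun k ↦ Eventually.of_forall (hr_bd k)) (Eventually.of_forall hlim)
    simpa using h
  -- Step 3: `E_k(s)` is non-decreasing in `k`, hence `E_k(s) ≤ 0`, hence `= 0`
  have hηmono : ∀ x, Monotone fun k ↦ η k x := fun x ↦ monotone_nat_of_le_succ fun k ↦ hmono k x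
  have hEi : ∀ k, Integrable (fun x ↦ w (x, s) ^ 2 * η k x) μ := fun k ↦
    ((hu.continuous.pow 2).mul (hηs k).continuous).integrable_of_hasCompactSupport (hηc k).mul_left
  have hEmono : ∀ k k', k ≤ k' → ∫ x, w (x, s) ^ 2 * η k x ∂μ ≤ ∫ x, w (x, s) ^ 2 * η k' x ∂μ :=
    fun k k' hkk' ↦ integral_mono (hEi k) (hEi k') fun x ↦
      mul_le_mul_of_nonneg_left (hηmono x hkk') (sq_nonneg _)
  have hE0 : ∀ k, ∫ x, w (x, s) ^ 2 * η k x ∂μ = 0 := by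
    intro k
    refine le_antisymm ?_ (integral_nonneg fun x ↦ mul_nonneg (sq_nonneg _) (hη01 k x).1)
    refine ge_of_tendsto hr_t ?_
    filter_upwards [eventually_ge_atTop k] with k' hk'
    exact (hEmono k k' hk').trans (hstep k')
  -- Step 4: the continuous nonnegative integrand vanishes identically; `η_k(x₀) = 1` for large `k`
  obtain ⟨k, hk⟩ := (hη1 x₀).exists
  have hk1 : η k x₀ = 1 := hk.self_of_nhds
  have hae : (fun x ↦ w (x, s) ^ 2 * η k x) =ᵐ[μ] 0 :=
    (integral_eq_zero_iff_of_nonneg (fun x ↦ mul_nonneg (sq_nonneg _) (hη01 k x).1) (hEi k)).1 (hE0 k)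
  have hzero : (fun x ↦ w (x, s) ^ 2 * η k x) = 0 :=
    (Continuous.ae_eq_iff_eq μ ((hu.continuous.pow 2).mul (hηs k).continuous) continuous_const).1 hae
  have hx := congrFun hzero x₀
  simp only [hk1, mul_one, Pi.zero_apply] at hx
  exact pow_eq_zero_iff (two_ne_zero) |>.1 hx

end Vanishing

/-! ### Borel's lemma in time on a compact subset of a manifold -/

section ManifoldBorel

variable {E : Type*} [NormedAddCommGroup E] [NormedSpace ℝ E] [FiniteDimensional ℝ E]
  {H : Type*} [TopologicalSpace H] {I : ModelWithCorners ℝ E H} [I.Boundaryless]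
  {M : Type*} [TopologicalSpace M] [ChartedSpace H M] [IsManifold I ∞ M] [T2Space M]

omit [FiniteDimensional ℝ E] [T2Space M] in
/-- **Chart transfer of Borel data with compact support**: for a smooth `ρ` with COMPACT support inside the
chart domain of `x₀` and smooth `a_k`, the functions `bₖ = 1_{Φ.target} · (ρ a_k) ∘ Φ⁻¹` (`Φ = extChartAt I x₀`)
are smooth on the model space and vanish off the compact set `Φ(tsupport ρ)` (copy of `exists_chart_borelData`
with the compactness of `tsupport ρ` as a hypothesis instead of `CompactSpace M`). [folklore] -/
theorem exists_chart_borelData_cs (x₀ : M) {ρ : M → ℝ} (hρ : ContMDiff I 𝓘(ℝ, ℝ) ∞ ρ)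
    (hρK : IsCompact (tsupport ρ)) (hρs : tsupport ρ ⊆ (chartAt H x₀).source) {a : ℕ → M → ℝ}
    (ha : ∀ k, ContMDiff I 𝓘(ℝ, ℝ) ∞ (a k)) :
    ∃ b : ℕ → E → ℝ, (∀ k, ContDiff ℝ ∞ (b k)) ∧ (∀ k, HasCompactSupport (b k)) ∧
      (∀ k, ∀ x ∈ (chartAt H x₀).source, b k (extChartAt I x₀ x) = ρ x * a k x) ∧
      (∀ k y, y ∉ extChartAt I x₀ '' tsupport ρ → b k y = 0) := by
  set Φ := extChartAt I x₀ with hΦ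
  have hsrc : (chartAt H x₀).source = Φ.source := by rw [hΦ, extChartAt_source]
  have hVt : IsOpen Φ.target := isOpen_extChartAt_target x₀
  -- the compact set
  set K : Set E := Φ '' tsupport ρ with hK
  have hKc : IsCompact K := by
    refine hρK.image_of_continuousOn ?_
    exact (continuousOn_extChartAt x₀).mono (by rwa [← hsrc])
  have hKt : K ⊆ Φ.target := by
    rintro _ ⟨x, hx, rfl⟩
    exact Φ.map_source (by rw [← hsrc]; exact hρs hx)
  -- the functions
  set b : ℕ → E → ℝ := fun k ↦ Φ.target.indicator fun y ↦ ρ (Φ.symm y) * a k (Φ.symm y) with hb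
  have hb_in : ∀ k, ∀ y ∈ Φ.target, b k y = ρ (Φ.symm y) * a k (Φ.symm y) :=
    fun k y hy ↦ by simp [hb, indicator_of_mem hy]
  have hb_out : ∀ k y, y ∉ K → b k y = 0 := by
    intro k y hy
    by_cases hyt : y ∈ Φ.target
    · rw [hb_in k y hyt]
      have : Φ.symm y ∉ tsupport ρ := by
        intro h'
        exact hy ⟨Φ.symm y, h', Φ.right_inv hyt⟩
      rw [image_eq_zero_of_notMem_tsupport this, zero_mul]
    · simp [hb, indicator_of_notMem hyt]
  have hb_chart : ∀ k, ∀ x ∈ (chartAt H x₀).source, b k (Φ x) = ρ x * a k x := by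
    intro k x hx
    rw [hsrc] at hx
    rw [hb_in k (Φ x) (Φ.map_source hx), Φ.left_inv hx]
  -- smoothness
  have hb_on : ∀ k, ContDiffOn ℝ ∞ (b k) Φ.target := by
    intro k
    have h1 : ContMDiffOn 𝓘(ℝ, E) 𝓘(ℝ, ℝ) ∞ (fun y ↦ ρ (Φ.symm y) * a k (Φ.symm y)) Φ.target :=
      ((hρ.mul (ha k)).comp_contMDiffOn (contMDiffOn_extChartAt_symm x₀))
    exact (contMDiffOn_iff_contDiffOn.1 h1).congr fun y hy ↦ hb_in k y hy
  have hbs : ∀ k, ContDiff ℝ ∞ (b k) := by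
    intro k
    rw [contDiff_iff_contDiffAt]
    intro y
    by_cases hy : y ∈ Φ.target
    · exact (hb_on k).contDiffAt (hVt.mem_nhds hy)
    · have hyK : y ∉ K := fun h ↦ hy (hKt h)
      have hev : b k =ᶠ[𝓝 y] fun _ ↦ 0 := by
        filter_upwards [hKc.isClosed.isOpen_compl.mem_nhds hyK] with z hz using hb_out k z hz
      exact (contDiffAt_const (c := (0 : ℝ))).congr_of_eventuallyEq hev
  have hbK : ∀ k, HasCompactSupport (b k) :=
    fun k ↦ HasCompactSupport.intro hKc fun y hy ↦ hb_out k y hy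
  exact ⟨b, hbs, hbK, hb_chart, hb_out⟩

variable [LocallyCompactSpace M] [SigmaCompactSpace M]

/-- **Borel's lemma in the time variable on a compact subset of a manifold**: for smooth `a_k : M → ℝ` all
vanishing off a compact `K` there is `W : ℝ → M → ℝ`, smooth on `M × ℝ`, with
`(d/ds)^k W(·, x)|_{s=0} = a_k(x)` for all `k, x`, and vanishing off a compact set. Proof: a finite cover of `K`
by chart domains inside a relatively compact open neighbourhood of `K`, a smooth partition of unity on `K`
subordinate to it, and Borel's lemma with parameters on the model space (`exists_borel_extension`), as in
`exists_contMDiff_forall_iteratedDeriv_eq_manifold`. [folklore] -/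
theorem exists_contMDiff_forall_iteratedDeriv_eq_of_isCompact {K : Set M} (hK : IsCompact K)
    {a : ℕ → M → ℝ} (ha : ∀ k, ContMDiff I 𝓘(ℝ, ℝ) ∞ (a k)) (haK : ∀ k x, x ∉ K → a k x = 0) :
    ∃ (W : ℝ → M → ℝ) (K' : Set M), IsCompact K' ∧
      ContMDiff (I.prod 𝓘(ℝ, ℝ)) 𝓘(ℝ, ℝ) ∞ (fun p : M × ℝ ↦ W p.2 p.1) ∧
      (∀ (k : ℕ) (x : M), iteratedDeriv k (fun s ↦ W s x) 0 = a k x) ∧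
      ∀ s x, x ∉ K' → W s x = 0 := by
  classical
  -- a relatively compact open neighbourhood `V` of `K`, a finite chart cover of `K` inside `V`
  obtain ⟨K₀, hK₀c, hKK₀⟩ := exists_compact_superset hK
  set V : Set M := interior K₀ with hVdef
  have hVo : IsOpen V := isOpen_interior
  have hKV : K ⊆ V := hKK₀
  have hVc : IsCompact (closure V) :=
    hK₀c.of_isClosed_subset isClosed_closure (closure_minimal interior_subset hK₀c.isClosed)
  obtain ⟨t, ht⟩ := hK.elim_finite_subcover (fun x : M ↦ (chartAt H x).source ∩ V)
    (fun x ↦ (chartAt H x).open_source.inter hVo)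
    (fun x hx ↦ mem_iUnion.2 ⟨x, mem_chart_source H x, hKV hx⟩)
  set U : ↥t → Set M := fun i ↦ (chartAt H (i : M)).source ∩ V with hU
  have hUo : ∀ i, IsOpen (U i) := fun i ↦ (chartAt H (i : M)).open_source.inter hVo
  have hUc : K ⊆ ⋃ i, U i := by
    intro x hx
    obtain ⟨i, hi, hx'⟩ := mem_iUnion₂.1 (ht hx)
    exact mem_iUnion.2 ⟨⟨i, hi⟩, hx'⟩
  obtain ⟨ρ, hρU⟩ := SmoothPartitionOfUnity.exists_isSubordinate I hK.isClosed U hUo hUc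
  have hρsrc : ∀ i, tsupport (ρ i) ⊆ (chartAt H (i : M)).source := fun i ↦
    (hρU i).trans inter_subset_left
  have hρcpt : ∀ i, IsCompact (tsupport (ρ i)) := fun i ↦
    hVc.of_isClosed_subset (isClosed_tsupport _) (((hρU i).trans inter_subset_right).trans subset_closure)
  -- chart-wise Borel data and Borel functions
  have hdata := fun i : ↥t ↦ exists_chart_borelData_cs (I := I) (i : M) (ρ i).contMDiff (hρcpt i)
    (hρsrc i) ha
  choose b hbs hbK hbchart hbout using hdata
  have hW := fun i : ↥t ↦ exists_borel_extension (b i) (hbs i) (hbK i) (fun _ ↦ 1) fun _ ↦ one_pos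
  choose ε hε hWcs hWcjet using hW
  set Wc : ↥t → E × ℝ → ℝ := fun i z ↦ ∑' k, cutoffMonomial k (ε i k) z.2 * b i k z.1 with hWc
  have hWczero : ∀ i y, (∀ k, b i k y = 0) → ∀ s, Wc i (y, s) = 0 := by
    intro i y hy s; simp [hWc, hy]
  -- transplant to `M`
  set Wt : ↥t → ℝ → M → ℝ := fun i s x ↦
    if x ∈ (chartAt H (i : M)).source then Wc i (extChartAt I (i : M) x, s) else 0 with hWt
  have hWt_zero' : ∀ i, ∀ x ∉ tsupport (ρ i), ∀ s, Wt i s x = 0 := by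
    intro i x' hx' s
    simp only [hWt]
    split_ifs with hsrc
    · apply hWczero i
      intro k
      apply hbout i k
      rintro ⟨x'', hx'', heq⟩
      have h1 : x'' ∈ (extChartAt I (i : M)).source := by
        rw [extChartAt_source]; exact hρsrc i hx''
      have h2 : x' ∈ (extChartAt I (i : M)).source := by rwa [extChartAt_source]
      have : x'' = x' := (extChartAt I (i : M)).injOn h1 h2 heq
      exact hx' (this ▸ hx'')
    · rfl
  have hWt_zero : ∀ i, ∀ x ∉ tsupport (ρ i), ∃ N ∈ 𝓝 x, ∀ x' ∈ N, ∀ s, Wt i s x' = 0 := by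
    intro i x hx
    exact ⟨(tsupport (ρ i))ᶜ, (isClosed_tsupport _).isOpen_compl.mem_nhds hx,
      fun x' hx' s ↦ hWt_zero' i x' hx' s⟩
  have hWt_smooth : ∀ i, ContMDiff (I.prod 𝓘(ℝ, ℝ)) 𝓘(ℝ, ℝ) ∞ (fun p : M × ℝ ↦ Wt i p.2 p.1) := by
    intro i
    rintro ⟨x, s⟩
    by_cases hx : x ∈ (chartAt H (i : M)).source
    · -- composition with the product chart on the chart domain
      have hsrc : x ∈ (extChartAt I (i : M)).source := by rwa [extChartAt_source]
      have hO : IsOpen ((extChartAt I (i : M)).source ×ˢ (univ : Set ℝ)) :=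
        (isOpen_extChartAt_source (i : M)).prod isOpen_univ
      have hmem : (x, s) ∈ (extChartAt I (i : M)).source ×ˢ (univ : Set ℝ) := ⟨hsrc, mem_univ _⟩
      have hcomp : ContMDiffWithinAt (I.prod 𝓘(ℝ, ℝ)) 𝓘(ℝ, ℝ) ∞
          (Wc i ∘ fun z : M × ℝ ↦ (extChartAt I (i : M) z.1, z.2))
          ((extChartAt I (i : M)).source ×ˢ (univ : Set ℝ)) (x, s) :=
        (hWcs i).comp_contMDiffWithinAt (contMDiffOn_extChartAt_prod_id (i : M) univ _ hmem)
      have heq : ∀ z ∈ (extChartAt I (i : M)).source ×ˢ (univ : Set ℝ),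
          Wt i z.2 z.1 = (Wc i ∘ fun z : M × ℝ ↦ (extChartAt I (i : M) z.1, z.2)) z := by
        rintro ⟨x', s'⟩ ⟨hx', -⟩
        have hx'' : x' ∈ (chartAt H (i : M)).source := by rwa [extChartAt_source] at hx'
        simp [hWt, hx'']
      exact ((hcomp.congr (fun z hz ↦ heq z hz) (heq _ hmem)).contMDiffAt (hO.mem_nhds hmem))
    · obtain ⟨N, hN, hN0⟩ := hWt_zero i x (fun h ↦ hx (hρsrc i h))
      have hev : (fun p : M × ℝ ↦ Wt i p.2 p.1) =ᶠ[𝓝 (x, s)] fun _ ↦ 0 := by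
        have : N ×ˢ (univ : Set ℝ) ∈ 𝓝 (x, s) := prod_mem_nhds hN univ_mem
        filter_upwards [this] with p hp using hN0 p.1 hp.1 p.2
      exact contMDiffAt_const.congr_of_eventuallyEq hev
  have hWt_jet : ∀ i k x, iteratedDeriv k (fun s ↦ Wt i s x) 0 = ρ i x * a k x := by
    intro i k x
    by_cases hx : x ∈ (chartAt H (i : M)).source
    · have h1 : (fun s ↦ Wt i s x) =
          fun s ↦ ∑' k, cutoffMonomial k (ε i k) s * b i k (extChartAt I (i : M) x) := by
        funext s; simp [hWt, hx, hWc]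
      rw [h1, hWcjet i, hbchart i k x hx]
    · have h1 : (fun s ↦ Wt i s x) = fun _ ↦ (0 : ℝ) := by
        funext s; simp [hWt, hx]
      rw [h1, iteratedDeriv_const, image_eq_zero_of_notMem_tsupport (fun h ↦ hx (hρsrc i h))]
      simp
  -- the sum over the cover
  refine ⟨fun s x ↦ ∑ i, Wt i s x, ⋃ i, tsupport (ρ i), isCompact_iUnion fun i ↦ hρcpt i,
    contMDiff_finsetSum fun i _ ↦ hWt_smooth i, fun k x ↦ ?_, fun s x hx ↦ ?_⟩
  · have h1 : (fun s ↦ ∑ i, Wt i s x) = ∑ i, (fun s ↦ Wt i s x) := by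
      funext s; simp only [Finset.sum_apply]
    rw [h1, iteratedDeriv_sum (fun i _ ↦ ((contDiff_time_slice (hWt_smooth i) x).contDiffAt.of_le
      (by exact_mod_cast le_top)))]
    simp_rw [hWt_jet]
    rw [← Finset.sum_mul]
    by_cases hxK : x ∈ K
    · have hone : ∑ i, ρ i x = 1 := by
        rw [← finsum_eq_sum_of_fintype]
        exact ρ.sum_eq_one hxK
      rw [hone, one_mul]
    · rw [haK k x hxK, mul_zero]
  · refine Finset.sum_eq_zero fun i _ ↦ hWt_zero' i x ?_ s
    exact fun h ↦ hx (mem_iUnion.2 ⟨i, h⟩)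

end ManifoldBorel

/-! ### The flat corrector with compact support -/

section Corrector

variable {n : ℕ} {M : Type*} [TopologicalSpace M] [T2Space M] [SecondCountableTopology M]
  [ChartedSpace (EuclideanSpace ℝ (Fin n)) M] [IsManifold (𝓡 n) ∞ M]

/-- A smooth time cut-off `θ : ℝ → ℝ` with `θ = 1` on `(−∞, 1/2]` and `θ = 0` on `[1, ∞)`. [folklore] -/
theorem exists_timeCutoff_half_one : ∃ θ : ℝ → ℝ, ContDiff ℝ ∞ θ ∧ (∀ s ≤ (1 / 2 : ℝ), θ s = 1) ∧
    ∀ s, (1 : ℝ) ≤ s → θ s = 0 := by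
  refine ⟨fun s ↦ Real.smoothTransition (2 - 2 * s),
    Real.smoothTransition.contDiff.comp (contDiff_const.sub (contDiff_const.mul contDiff_id)),
    fun s hs ↦ Real.smoothTransition.one_of_one_le (by linarith), fun s hs ↦
    Real.smoothTransition.zero_of_nonpos (by linarith)⟩

omit [T2Space M] [SecondCountableTopology M] in
/-- **The jets of the formal solution are supported in the support of the datum**: for a static metric
`g` and `x ∉ tsupport w₀`, `heatJet (heatOp (fun _ ↦ g) Q) w₀ k x = 0` — in fact every Taylor polynomial
`heatTaylor … k s` vanishes on the open set `(tsupport w₀)ᶜ` (locality of `Δ_g`). [folklore] -/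
theorem heatTaylor_eq_zero_of_notMem_tsupport
    (g : PseudoRiemannianMetric (𝓡 n) ∞ (EuclideanSpace ℝ (Fin n)) (TangentSpace (𝓡 n) : M → Type _))
    (Q : ℝ → M → ℝ) (w₀ : M → ℝ) (k : ℕ) :
    ∀ s, ∀ x ∉ tsupport w₀, heatTaylor (heatOp (fun _ ↦ g) Q) w₀ k s x = 0 := by
  haveI := g.hasLeviCivita
  induction k with
  | zero =>
    intro s x hx
    exact image_eq_zero_of_notMem_tsupport hx
  | succ k IH =>
    intro s x hx
    rw [heatTaylor_succ, IH s x hx, zero_add]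
    have hL : ∀ r, heatOp (fun _ ↦ g) Q r (heatTaylor (heatOp (fun _ ↦ g) Q) w₀ k r) x = 0 := by
      intro r
      rw [heatOp_apply, IH r x hx, mul_zero, sub_zero, laplaceBeltrami_eq_dalembertian]
      refine g.dalembertian_eq_zero_of_eventuallyEq_zero ?_
      filter_upwards [(isClosed_tsupport w₀).isOpen_compl.mem_nhds hx] with y hy
      exact IH r y hy
    have h0 : (fun r ↦ heatOp (fun _ ↦ g) Q r (heatTaylor (heatOp (fun _ ↦ g) Q) w₀ k r) x) =
        fun _ ↦ (0 : ℝ) := funext hL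
    rw [h0, iteratedDeriv_const]
    simp

omit [T2Space M] [SecondCountableTopology M] in
/-- The jets vanish off the support of the datum. [folklore] -/
theorem heatJet_eq_zero_of_notMem_tsupport
    (g : PseudoRiemannianMetric (𝓡 n) ∞ (EuclideanSpace ℝ (Fin n)) (TangentSpace (𝓡 n) : M → Type _))
    (Q : ℝ → M → ℝ) (w₀ : M → ℝ) (k : ℕ) (x : M) (hx : x ∉ tsupport w₀) :
    heatJet (heatOp (fun _ ↦ g) Q) w₀ k x = 0 := by
  unfold heatJet
  have h0 : (fun s ↦ heatTaylor (heatOp (fun _ ↦ g) Q) w₀ k s x) = fun _ ↦ (0 : ℝ) :=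
    funext fun s ↦ heatTaylor_eq_zero_of_notMem_tsupport g Q w₀ k s x hx
  rw [h0, iteratedDeriv_const]
  simp

/-- **The flat corrector for compactly supported data on a non-compact manifold**: reduction of the Cauchy
problem `∂ₛw = Δ_g w − Qw`, `w(0) = w₀ ∈ C_c^∞` on a (non-compact) manifold to a
problem with a smooth forcing supported in `K × [0, 1]`, `K` compact: `W`, `G` smooth on `M × ℝ`, `W(0) = w₀`,
`W = G = 0` off `K` and for `s ≥ 1`, `G = 0` for `s ≤ 0`, `G = −(∂ₛW − Δ_g W + QW)` for `s ≥ 0`.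
[cite: Treves1975, §41] -/
theorem exists_flatCorrector_of_hasCompactSupport
    (g : PseudoRiemannianMetric (𝓡 n) ∞ (EuclideanSpace ℝ (Fin n)) (TangentSpace (𝓡 n) : M → Type _))
    {Q : ℝ → M → ℝ} (hQ : ContMDiff ((𝓡 n).prod 𝓘(ℝ, ℝ)) 𝓘(ℝ, ℝ) ∞ (fun p : M × ℝ ↦ Q p.2 p.1))
    {w₀ : M → ℝ} (hw₀ : ContMDiff (𝓡 n) 𝓘(ℝ, ℝ) ∞ w₀) (hw₀c : HasCompactSupport w₀) :
    ∃ (W G : ℝ → M → ℝ) (K : Set M), IsCompact K ∧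
      ContMDiff ((𝓡 n).prod 𝓘(ℝ, ℝ)) 𝓘(ℝ, ℝ) ∞ (fun p : M × ℝ ↦ W p.2 p.1) ∧
      ContMDiff ((𝓡 n).prod 𝓘(ℝ, ℝ)) 𝓘(ℝ, ℝ) ∞ (fun p : M × ℝ ↦ G p.2 p.1) ∧ W 0 = w₀ ∧
      (∀ s x, x ∉ K → W s x = 0) ∧ (∀ s x, x ∉ K → G s x = 0) ∧
      (∀ s, 1 ≤ s → ∀ x, W s x = 0 ∧ G s x = 0) ∧ (∀ s ≤ 0, ∀ x, G s x = 0) ∧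
      ∀ s, 0 ≤ s → ∀ x, G s x = -(deriv (fun r ↦ W r x) s - (g.laplaceBeltrami (W s) x - Q s x * W s x)) := by
  classical
  haveI : LocallyCompactSpace M := ChartedSpace.locallyCompactSpace (EuclideanSpace ℝ (Fin n)) M
  haveI := g.hasLeviCivita
  set h : ℝ → PseudoRiemannianMetric (𝓡 n) ∞ (EuclideanSpace ℝ (Fin n)) (TangentSpace (𝓡 n) : M → Type _) :=
    fun _ ↦ g with hh'
  have hh : IsContMDiffFamilyOn ∞ h univ := isContMDiffFamilyOn_const g univ
  -- Borel's lemma on the compact support of the datum, with the jets of the formal solution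
  obtain ⟨W₁, K, hKc, hW₁s, hW₁jet, hW₁K⟩ :=
    exists_contMDiff_forall_iteratedDeriv_eq_of_isCompact (I := 𝓡 n) hw₀c.isCompact
      (a := heatJet (heatOp h Q) w₀) (contMDiff_heatJet hh hQ hw₀)
      (fun k x hx ↦ heatJet_eq_zero_of_notMem_tsupport g Q w₀ k x hx)
  -- the time cut-off
  obtain ⟨θ, hθs, hθ1, hθ0⟩ := exists_timeCutoff_half_one
  set W : ℝ → M → ℝ := fun s x ↦ θ s * W₁ s x with hWdef
  have hWs : ContMDiff ((𝓡 n).prod 𝓘(ℝ, ℝ)) 𝓘(ℝ, ℝ) ∞ (fun p : M × ℝ ↦ W p.2 p.1) :=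
    ((contMDiff_iff_contDiff.2 hθs).comp contMDiff_snd).mul hW₁s
  have hWev : ∀ x, (fun s ↦ W s x) =ᶠ[𝓝 0] fun s ↦ W₁ s x := fun x ↦ by
    filter_upwards [Iio_mem_nhds (by norm_num : (0 : ℝ) < 1 / 2)] with s hs
    simp [hWdef, hθ1 s hs.le]
  have hWjet : ∀ (k : ℕ) (x : M), iteratedDeriv k (fun s ↦ W s x) 0 = heatJet (heatOp h Q) w₀ k x :=
    fun k x ↦ by rw [(hWev x).iteratedDeriv_eq, hW₁jet k x]
  have hWK : ∀ s x, x ∉ K → W s x = 0 := fun s x hx ↦ by simp [hWdef, hW₁K s x hx]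
  have hW1 : ∀ s, 1 ≤ s → ∀ x, W s x = 0 := fun s hs x ↦ by simp [hWdef, hθ0 s hs]
  -- the residual and its flatness
  set F : ℝ → M → ℝ := fun s x ↦ -(deriv (fun r ↦ W r x) s - heatOp h Q s (W s) x) with hF
  have hFs : ContMDiff ((𝓡 n).prod 𝓘(ℝ, ℝ)) 𝓘(ℝ, ℝ) ∞ (fun p : M × ℝ ↦ F p.2 p.1) := by
    have h1 : ContMDiff ((𝓡 n).prod 𝓘(ℝ, ℝ)) 𝓘(ℝ, ℝ) ∞
        (fun p : M × ℝ ↦ deriv (fun r ↦ W r p.1) p.2) := by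
      have := contMDiff_iteratedDeriv_time hWs 1
      simpa only [iteratedDeriv_one] using this
    exact (h1.sub (contMDiff_heatOp' hh hQ hWs)).neg
  have hFflat : ∀ (x : M) (i : ℕ), iteratedDeriv i (fun s ↦ F s x) 0 = 0 := by
    intro x i
    have h1 : (fun s ↦ F s x) = fun s ↦ -(deriv (fun r ↦ W r x) s - heatOp h Q s (W s) x) := rfl
    rw [h1, iteratedDeriv_fun_neg, iteratedDeriv_residual_eq_zero hh hQ hw₀ hWs hWjet x i, neg_zero]
  -- the residual vanishes off `K` and for `s ≥ 1`
  have hFzero : ∀ s x, (∀ᶠ y in 𝓝 x, ∀ r, W r y = 0) → F s x = 0 := by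
    intro s x hx
    have hx0 : ∀ r, W r x = 0 := fun r ↦ hx.self_of_nhds r
    have hd : deriv (fun r ↦ W r x) s = 0 := by
      have : (fun r ↦ W r x) = fun _ ↦ (0 : ℝ) := funext hx0
      rw [this, deriv_const]
    have hL : heatOp h Q s (W s) x = 0 := by
      rw [heatOp_apply, hx0 s, mul_zero, sub_zero]
      show g.laplaceBeltrami (W s) x = 0
      rw [laplaceBeltrami_eq_dalembertian]
      exact g.dalembertian_eq_zero_of_eventuallyEq_zero (hx.mono fun y hy ↦ hy s)
    show -(deriv (fun r ↦ W r x) s - heatOp h Q s (W s) x) = 0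
    rw [hd, hL]; simp
  have hFK : ∀ s x, x ∉ K → F s x = 0 := fun s x hx ↦ by
    refine hFzero s x ?_
    filter_upwards [hKc.isClosed.isOpen_compl.mem_nhds hx] with y hy r using hWK r y hy
  have hFtime : ∀ s x, (∀ᶠ r in 𝓝 s, ∀ y, W r y = 0) → F s x = 0 := by
    intro s x hs
    have hs0 : ∀ y, W s y = 0 := hs.self_of_nhds
    have hd : deriv (fun r ↦ W r x) s = 0 := by
      rw [Filter.EventuallyEq.deriv_eq (hs.mono fun r hr ↦ hr x)]
      exact deriv_const s 0
    have hL : heatOp h Q s (W s) x = 0 := by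
      have : W s = fun _ ↦ (0 : ℝ) := funext hs0
      rw [heatOp_apply, this]
      show g.laplaceBeltrami (fun _ : M ↦ (0 : ℝ)) x - Q s x * 0 = 0
      rw [mul_zero, sub_zero, laplaceBeltrami_eq_dalembertian]
      exact g.dalembertian_eq_zero_of_eventuallyEq_zero (Eventually.of_forall fun _ ↦ rfl)
    show -(deriv (fun r ↦ W r x) s - heatOp h Q s (W s) x) = 0
    rw [hd, hL]; simp
  have hF1 : ∀ s, 1 < s → ∀ x, F s x = 0 := fun s hs x ↦ by
    refine hFtime s x ?_
    filter_upwards [Ioi_mem_nhds hs] with r hr y using hW1 r hr.le y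
  -- the forcing `G = 1_{s > 0} F`
  refine ⟨W, fun s x ↦ if 0 < s then F s x else 0, K, hKc, hWs, contMDiff_timeCutoff_manifold hFs hFflat,
    ?_, hWK, ?_, ?_, ?_, ?_⟩
  · funext x
    have := hWjet 0 x
    rw [iteratedDeriv_zero, heatJet_zero] at this
    exact this
  · intro s x hx
    by_cases hs : 0 < s
    · simp [hs, hFK s x hx]
    · simp [hs]
  · intro s hs x
    refine ⟨hW1 s hs x, ?_⟩
    rcases hs.lt_or_eq with hs' | rfl
    · simp [hF1 s hs' x]
    · -- at `s = 1`: `F 1 x = 0` by continuity from the right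
      have hcont : Continuous fun r ↦ F r x :=
        (contDiff_time_slice hFs x).continuous
      have hlim : Tendsto (fun r ↦ F r x) (𝓝[>] 1) (𝓝 (F 1 x)) := hcont.continuousAt.continuousWithinAt
      have hev : (fun r ↦ F r x) =ᶠ[𝓝[>] 1] fun _ ↦ 0 := by
        filter_upwards [self_mem_nhdsWithin] with r hr using hF1 r hr x
      have h0 : F 1 x = 0 := tendsto_nhds_unique hlim (tendsto_const_nhds.congr' hev.symm)
      simp [h0]
  · intro s hs x
    simp [not_lt.2 hs]
  · intro s hs x
    rcases hs.lt_or_eq with hs' | rfl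
    · simp [hs', hF, hh']
    · have := hFflat x 0
      rw [iteratedDeriv_zero] at this
      simp only [hF, heatOp_apply] at this
      simp only [lt_irrefl, if_false]
      show (0 : ℝ) = -(deriv (fun r ↦ W r x) 0 - (g.laplaceBeltrami (W 0) x - Q 0 x * W 0 x))
      linarith

end Corrector

/-! ### The Cauchy problem -/

section Cauchy

variable {n : ℕ} {M : Type*} [TopologicalSpace M] [T2Space M] [SecondCountableTopology M]
  [ChartedSpace (EuclideanSpace ℝ (Fin n)) M] [IsManifold (𝓡 n) ∞ M] [T3Space M] [MeasurableSpace M]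
  [BorelSpace M]
  {g : PseudoRiemannianMetric (𝓡 n) ∞ (EuclideanSpace ℝ (Fin n)) (TangentSpace (𝓡 n) : M → Type _)}
  [g.HasLeviCivita]

/-- **The forced static problem on a complete manifold** (non-compact `exists_smooth_linearHeat_forcing`):
for `Q ≥ 1` smooth, `G` smooth with compact support in `M × ℝ` and `G = 0` for `s ≤ 0`, and Laplacian
cut-offs `η_k` (`IsLaplacianCutoff g η C`), there is `v` smooth on `M × (−∞, b)` with `v = 0` for `s ≤ 0`,
`∂ₛv = Δ_g v − Qv + G` on `M × (−∞, b)`, and `v ∈ L²(M × ℝ, dV ⊗ ds)`-a.e. equal to Lions' solution, in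
particular `v² ∈ L¹(M × (0, b'))` for `b' < b`. [cite: Treves1975, §41, Thm. 40.1] -/
theorem exists_smooth_linearHeat_forcing_static (hg : g.IsRiemannian)
    {η : ℕ → M → ℝ} {C : ℝ} (hη : IsLaplacianCutoff g η C)
    {Q G : ℝ → M → ℝ} (hQ : ContMDiff ((𝓡 n).prod 𝓘(ℝ, ℝ)) 𝓘(ℝ, ℝ) ∞ (fun p : M × ℝ ↦ Q p.2 p.1))
    (hQ1 : ∀ s x, 1 ≤ Q s x)
    (hG : ContMDiff ((𝓡 n).prod 𝓘(ℝ, ℝ)) 𝓘(ℝ, ℝ) ∞ (fun p : M × ℝ ↦ G p.2 p.1))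
    (hGc : HasCompactSupport (fun p : M × ℝ ↦ G p.2 p.1)) (hG0 : ∀ s ≤ (0 : ℝ), ∀ x, G s x = 0)
    {b : ℝ} (hb : 0 < b) :
    ∃ v : M × ℝ → ℝ, ContMDiffOn ((𝓡 n).prod 𝓘(ℝ, ℝ)) 𝓘(ℝ, ℝ) ∞ v (univ ×ˢ Iio b) ∧
      (∀ x, ∀ s ≤ (0 : ℝ), v (x, s) = 0) ∧
      (∀ x, ∀ s < b, deriv (fun r ↦ v (x, r)) s =
        g.laplaceBeltrami (fun y ↦ v (y, s)) x - Q s x * v (x, s) + G s x) ∧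
      Integrable (fun p : M × ℝ ↦ v p ^ 2) ((g.riemVolume.prod (volume : Measure ℝ)).restrict
        (univ ×ˢ Ioo 0 b)) := by
  classical
  haveI : LocallyCompactSpace M := ChartedSpace.locallyCompactSpace (EuclideanSpace ℝ (Fin n)) M
  haveI := CarrilloNi2009_shrinkerLSI.isFiniteMeasureOnCompacts_riemVolume hg
  set μ₀ : Measure M := g.riemVolume with hμ₀
  haveI : μ₀.IsOpenPosMeasure := isOpenPosMeasure_riemVolume hg
  haveI : (μ₀.prod (volume : Measure ℝ)).IsOpenPosMeasure := Measure.prod.instIsOpenPosMeasure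
  haveI : SigmaFinite μ₀ := sigmaFinite_riemVolume hg
  have hab : (-2 : ℝ) < b := by linarith
  -- Lions' very weak solution on `M × (-2, b)`, extended by zero: very weak on `M × (-∞, b)`
  obtain ⟨u, hum, hu2, hu0, huweak⟩ := exists_isVeryWeakHeatSol_static hg hQ hG hGc hab
    (fun s hs x ↦ hG0 s (by linarith) x) (fun x s _ ↦ hQ1 s x)
  -- interior regularity on the open time set `(-∞, b)`
  obtain ⟨v, hv, hae⟩ := exists_contMDiffOn_ae_eq_of_staticLinearHeat_veryWeak hg hQ hG isOpen_Iio hum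
    huweak.locallyIntegrableOn huweak.integral_eq
  -- the weak identity for the smooth representative
  have hvweak : IsVeryWeakHeatSol g Q G (Iio b) v := huweak.congr_ae isOpen_Iio hae
  -- the classical equation on `M × (-∞, b)`
  have hclass : ∀ x, ∀ s < b, deriv (fun r ↦ v (x, r)) s =
      g.laplaceBeltrami (fun y ↦ v (y, s)) x - Q s x * v (x, s) + G s x := by
    intro x s hs
    have h := linearHeat_classical_of_isVeryWeakHeatSol hg hQ hG isOpen_Iio hv hvweak (x, s)
      ⟨mem_univ _, hs⟩
    simp only at h
    linarith
  -- `v = 0` on `M × (-∞, -2)`, where `u = 0`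
  have hv0 : ∀ x, ∀ s < (-2 : ℝ), v (x, s) = 0 := by
    have hO : IsOpen ((univ : Set M) ×ˢ Iio (-2 : ℝ)) := isOpen_univ.prod isOpen_Iio
    have hsub : (univ : Set M) ×ˢ Iio (-2 : ℝ) ⊆ univ ×ˢ Iio b :=
      Set.prod_mono le_rfl (Iio_subset_Iio hab.le)
    have heq : EqOn v 0 ((univ : Set M) ×ˢ Iio (-2 : ℝ)) := by
      refine Measure.eqOn_open_of_ae_eq (μ := μ₀.prod (volume : Measure ℝ)) ?_ hO
        (hv.mono hsub).continuousOn continuousOn_const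
      rw [Filter.EventuallyEq, ae_restrict_iff' hO.measurableSet]
      filter_upwards [hae] with p hp hpO
      rw [← hp (hsub hpO), Pi.zero_apply]
      exact hu0 p fun h' ↦ lt_irrefl _ (h'.1.trans hpO.2)
    intro x s hs
    exact heq ⟨mem_univ _, hs⟩
  -- `v² ∈ L¹` of every strip inside `(-∞, b)` (`v = u` a.e., `u ∈ L²`)
  have hu2sq : Integrable (fun p : M × ℝ ↦ u p ^ 2) (μ₀.prod (volume : Measure ℝ)) := by
    have := hu2.integrable_norm_rpow two_ne_zero ENNReal.ofNat_ne_top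
    refine this.congr (Eventually.of_forall fun p ↦ ?_)
    simp [Real.norm_eq_abs, sq_abs]
  have hv2 : ∀ a' b' : ℝ, b' ≤ b → Integrable (fun p : M × ℝ ↦ v p ^ 2)
      ((μ₀.prod (volume : Measure ℝ)).restrict (univ ×ˢ Ioo a' b')) := by
    intro a' b' hb'
    refine (hu2sq.restrict (s := univ ×ˢ Ioo a' b')).congr ?_
    rw [Filter.EventuallyEq, ae_restrict_iff' (MeasurableSet.univ.prod measurableSet_Ioo)]
    filter_upwards [hae] with p hp hpS
    rw [hp ⟨mem_univ _, lt_of_lt_of_le hpS.2.2 hb'⟩]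
  -- `v = 0` on `M × [-3, 0]` by energy uniqueness for the homogeneous equation
  have hv00 : ∀ s ∈ Icc (-3 : ℝ) 0, ∀ x, v (x, s) = 0 := by
    intro s hs x
    refine energyVanishing_of_isLaplacianCutoff hg hη (Q := Q) (a := -3) (b := 0) (O := Iio b) (w := v)
      isOpen_Iio (fun s hs ↦ lt_of_le_of_lt hs.2 hb)
      (fun s _ x ↦ zero_le_one.trans (hQ1 s x)) hv ?_ ?_ ?_ hs x
    · intro s hs x
      rw [hclass x s (lt_of_le_of_lt hs.2 hb), hG0 s hs.2 x, add_zero, laplaceBeltrami_eq_dalembertian]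
    · intro x
      exact hv0 x (-3) (by norm_num)
    · exact hv2 (-3) 0 hb.le
  refine ⟨v, hv, fun x s hs ↦ ?_, hclass, hv2 0 b le_rfl⟩
  rcases lt_or_ge s (-2) with hs' | hs'
  · exact hv0 x s hs'
  · exact hv00 s ⟨by linarith, hs⟩ x


/-- **The linear heat Cauchy problem `∂ₛw = Δ_g w − Qw`, `w(0) = W(0)`, on a complete manifold with
Laplacian cut-offs, for flat-corrector data `(W, G, K)`** (`W`, `G` smooth on `M × ℝ`, vanishing off the
compact `K` and for `s ≥ 1`, `G = 0` for `s ≤ 0`, `G = −(∂ₛW − ΔW + QW)` for `s ≥ 0`; `Q ≥ 1` smooth): for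
every `T > 0` a solution smooth on `M × O`, `O ⊇ [0, T]` open, with `w(0) = W(0)`, the equation (two-sided
`deriv`) on `[0, T]`, and `w ∈ L²(M × (0, T))`. Proof: `w = W + v` with `v` the forced solution
`exists_smooth_linearHeat_forcing_static`. [cite: Treves1975, §41, Thm. 40.1] -/
theorem exists_linearHeat_forcedData_noncompact (hg : g.IsRiemannian) {η : ℕ → M → ℝ} {C : ℝ}
    (hη : IsLaplacianCutoff g η C) {Q : ℝ → M → ℝ}
    (hQ : ContMDiff ((𝓡 n).prod 𝓘(ℝ, ℝ)) 𝓘(ℝ, ℝ) ∞ (fun p : M × ℝ ↦ Q p.2 p.1)) (hQ1 : ∀ s x, 1 ≤ Q s x)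
    {W G : ℝ → M → ℝ} {K : Set M} (hK : IsCompact K)
    (hW : ContMDiff ((𝓡 n).prod 𝓘(ℝ, ℝ)) 𝓘(ℝ, ℝ) ∞ (fun p : M × ℝ ↦ W p.2 p.1))
    (hG : ContMDiff ((𝓡 n).prod 𝓘(ℝ, ℝ)) 𝓘(ℝ, ℝ) ∞ (fun p : M × ℝ ↦ G p.2 p.1))
    (hWK : ∀ s x, x ∉ K → W s x = 0) (hGK : ∀ s x, x ∉ K → G s x = 0)
    (hWG1 : ∀ s, 1 ≤ s → ∀ x, W s x = 0 ∧ G s x = 0) (hG0 : ∀ s ≤ 0, ∀ x, G s x = 0)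
    (hGW : ∀ s, 0 ≤ s → ∀ x, G s x = -(deriv (fun r ↦ W r x) s - (g.laplaceBeltrami (W s) x - Q s x * W s x)))
    {T : ℝ} (hT : 0 < T) :
    ∃ (O : Set ℝ) (w : ℝ → M → ℝ), IsOpen O ∧ Icc 0 T ⊆ O ∧
      ContMDiffOn ((𝓡 n).prod 𝓘(ℝ, ℝ)) 𝓘(ℝ, ℝ) ∞ (fun p : M × ℝ ↦ w p.2 p.1) (univ ×ˢ O) ∧
      (∀ x, w 0 x = W 0 x) ∧
      (∀ s ∈ Icc 0 T, ∀ x, deriv (fun r ↦ w r x) s = g.dalembertian (w s) x - Q s x * w s x) ∧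
      Integrable (fun p : M × ℝ ↦ w p.2 p.1 ^ 2)
        ((g.riemVolume.prod (volume : Measure ℝ)).restrict (univ ×ˢ Ioo 0 T)) := by
  classical
  haveI : LocallyCompactSpace M := ChartedSpace.locallyCompactSpace (EuclideanSpace ℝ (Fin n)) M
  haveI := CarrilloNi2009_shrinkerLSI.isFiniteMeasureOnCompacts_riemVolume hg
  haveI : SigmaFinite g.riemVolume := sigmaFinite_riemVolume hg
  -- `G` has compact support in `K × [0, 1]`
  have hGc : HasCompactSupport (fun p : M × ℝ ↦ G p.2 p.1) := by
    refine HasCompactSupport.intro (hK.prod (isCompact_Icc (a := (0 : ℝ)) (b := 1))) ?_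
    rintro ⟨x, s⟩ hp
    simp only [mem_prod, mem_Icc, not_and_or, not_le] at hp
    rcases hp with hx | hs | hs
    · exact hGK s x hx
    · exact hG0 s hs.le x
    · exact (hWG1 s hs.le x).2
  set b : ℝ := T + 1 with hbdef
  have hb : 0 < b := by rw [hbdef]; linarith
  obtain ⟨v, hv, hv0, hveq, hvL2⟩ := exists_smooth_linearHeat_forcing_static hg hη hQ hQ1 hG hGc hG0 hb
  -- the solution `w = W + v`
  set w : ℝ → M → ℝ := fun s x ↦ W s x + v (x, s) with hwdef
  have hws : ContMDiffOn ((𝓡 n).prod 𝓘(ℝ, ℝ)) 𝓘(ℝ, ℝ) ∞ (fun p : M × ℝ ↦ w p.2 p.1) (univ ×ˢ Iio b) :=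
    hW.contMDiffOn.add hv
  refine ⟨Iio b, w, isOpen_Iio, fun s hs ↦ by simp only [mem_Iio, hbdef]; linarith [hs.2], hws, fun x ↦ ?_,
    fun s hs x ↦ ?_, ?_⟩
  · simp [hwdef, hv0 x 0 le_rfl]
  · -- the equation on `[0, T]`
    have hsb : s < b := by rw [hbdef]; linarith [hs.2]
    have hdW : HasDerivAt (fun r ↦ W r x) (deriv (fun r ↦ W r x) s) s :=
      ((contDiff_time_slice hW x).differentiable (by simp)).differentiableAt.hasDerivAt
    have hdv : HasDerivAt (fun r ↦ v (x, r)) (deriv (fun r ↦ v (x, r)) s) s :=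
      hasDerivAt_slice_of_contMDiffOn isOpen_Iio hv x hsb
    have hd : deriv (fun r ↦ w r x) s = deriv (fun r ↦ W r x) s + deriv (fun r ↦ v (x, r)) s :=
      (hdW.add hdv).deriv
    have h2 : (2 : ℕ∞ω) ≤ (∞ : ℕ∞ω) := by norm_cast
    have hWs2 : ContMDiffAt (𝓡 n) 𝓘(ℝ, ℝ) 2 (W s) x :=
      ((contMDiff_space_slice hW s).of_le h2).contMDiffAt
    have hvs2 : ContMDiffAt (𝓡 n) 𝓘(ℝ, ℝ) 2 (fun y ↦ v (y, s)) x := by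
      have hO : IsOpen ((univ : Set M) ×ˢ Iio b) := isOpen_univ.prod isOpen_Iio
      have h1 : ContMDiffOn (𝓡 n) 𝓘(ℝ, ℝ) ∞ (fun y ↦ v (y, s)) univ := fun y _ ↦
        (hv.comp_contMDiff (f := fun y : M ↦ ((y, s) : M × ℝ)) (contMDiff_id.prodMk contMDiff_const)
          (fun y ↦ ⟨mem_univ _, hsb⟩)).contMDiffAt.contMDiffWithinAt
      exact ((contMDiffOn_univ.1 h1).of_le h2).contMDiffAt
    have hΔ : g.dalembertian (w s) x = g.dalembertian (W s) x + g.dalembertian (fun y ↦ v (y, s)) x := by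
      have := g.dalembertian_add_of_contMDiffAt hWs2 hvs2
      simpa [hwdef, Pi.add_def] using this
    have hGW' := hGW s hs.1 x
    have hveq' := hveq x s hsb
    rw [laplaceBeltrami_eq_dalembertian] at hGW' hveq'
    simp only [hwdef]
    rw [hd, hΔ]
    linarith
  · -- `w² ∈ L¹(M × (0, T))`: `W` is bounded with compact spatial support, `v ∈ L²`
    have hmeasS : MeasurableSet ((univ : Set M) ×ˢ Ioo (0 : ℝ) T) := MeasurableSet.univ.prod measurableSet_Ioo
    have hvT : Integrable (fun p : M × ℝ ↦ v p ^ 2)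
        ((g.riemVolume.prod (volume : Measure ℝ)).restrict (univ ×ˢ Ioo 0 T)) := by
      refine hvL2.mono_measure (Measure.restrict_mono (Set.prod_mono le_rfl (Ioo_subset_Ioo le_rfl ?_)) le_rfl)
      rw [hbdef]; linarith
    obtain ⟨B, hB⟩ := (hK.prod (isCompact_Icc (a := (0 : ℝ)) (b := T))).exists_bound_of_continuousOn
      (f := fun p : M × ℝ ↦ W p.2 p.1) hW.continuous.continuousOn
    have hWbd : ∀ p ∈ (univ : Set M) ×ˢ Ioo (0 : ℝ) T,
        ‖W p.2 p.1‖ ≤ (K ×ˢ (univ : Set ℝ)).indicator (fun _ ↦ max B 0) p := by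
      rintro ⟨x, s⟩ ⟨-, hs⟩
      by_cases hx : x ∈ K
      · rw [indicator_of_mem (show ((x, s) : M × ℝ) ∈ K ×ˢ (univ : Set ℝ) from ⟨hx, mem_univ _⟩)]
        exact (hB (x, s) ⟨hx, Ioo_subset_Icc_self hs⟩).trans (le_max_left _ _)
      · rw [indicator_of_notMem (show ((x, s) : M × ℝ) ∉ K ×ˢ (univ : Set ℝ) from fun h ↦ hx h.1)]
        simp [hWK s x hx]
    set ν : Measure (M × ℝ) := (g.riemVolume.prod (volume : Measure ℝ)).restrict (univ ×ˢ Ioo 0 T) with hν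
    have hKfin : ν (K ×ˢ (univ : Set ℝ)) ≠ (⊤ : ℝ≥0∞) := by
      rw [hν, Measure.restrict_apply (hK.measurableSet.prod MeasurableSet.univ)]
      have h1 : K ×ˢ (univ : Set ℝ) ∩ (univ : Set M) ×ˢ Ioo (0 : ℝ) T = K ×ˢ Ioo (0 : ℝ) T := by
        ext ⟨x, s⟩; simp [mem_prod]
      rw [h1, Measure.prod_prod]
      exact (ENNReal.mul_lt_top (hK.measure_lt_top) measure_Ioo_lt_top).ne
    have hdom : Integrable (fun p : M × ℝ ↦ ((K ×ˢ (univ : Set ℝ)).indicator (fun _ ↦ max B 0) p) ^ 2 +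
        v p ^ 2 + 2 * (((K ×ˢ (univ : Set ℝ)).indicator (fun _ ↦ max B 0) p) * |v p|)) ν := by
      have hI : Integrable (fun p : M × ℝ ↦ (K ×ˢ (univ : Set ℝ)).indicator (fun _ ↦ max B 0) p) ν :=
        (integrableOn_const (C := max B 0) hKfin).integrable_indicator (hK.measurableSet.prod MeasurableSet.univ)
      have hI2 : Integrable (fun p : M × ℝ ↦ ((K ×ˢ (univ : Set ℝ)).indicator (fun _ ↦ max B 0) p) ^ 2) ν := by
        have : (fun p : M × ℝ ↦ ((K ×ˢ (univ : Set ℝ)).indicator (fun _ ↦ max B 0) p) ^ 2) =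
            (K ×ˢ (univ : Set ℝ)).indicator (fun _ ↦ (max B 0) ^ 2) := by
          funext p
          by_cases hp : p ∈ K ×ˢ (univ : Set ℝ)
          · simp [indicator_of_mem hp]
          · simp [indicator_of_notMem hp]
        rw [this]
        exact (integrableOn_const (C := (max B 0) ^ 2) hKfin).integrable_indicator
          (hK.measurableSet.prod MeasurableSet.univ)
      -- `indicator * |v|` is dominated by `indicator² + v²` up to the factor 1/2; use `2ab ≤ a² + b²`
      have hIv : Integrable (fun p : M × ℝ ↦ ((K ×ˢ (univ : Set ℝ)).indicator (fun _ ↦ max B 0) p) * |v p|) ν := by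
        refine (hI2.add hvT).mono' ?_ (Eventually.of_forall fun p ↦ ?_)
        · refine (hI.aestronglyMeasurable.mul ?_)
          have hvc : ContinuousOn v ((univ : Set M) ×ˢ Ioo (0 : ℝ) T) :=
            hv.continuousOn.mono (Set.prod_mono le_rfl fun s hs ↦ by
              simp only [mem_Iio, hbdef]; linarith [hs.2])
          exact (hvc.aestronglyMeasurable hmeasS).norm.congr (Eventually.of_forall fun p ↦ by
            simp [Real.norm_eq_abs])
        · show ‖(K ×ˢ (univ : Set ℝ)).indicator (fun _ ↦ max B 0) p * |v p|‖ ≤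
            ((K ×ˢ (univ : Set ℝ)).indicator (fun _ ↦ max B 0) p) ^ 2 + v p ^ 2
          rw [Real.norm_eq_abs, abs_mul, abs_abs]
          have ha : 0 ≤ (K ×ˢ (univ : Set ℝ)).indicator (fun _ ↦ max B 0) p := by
            by_cases hp : p ∈ K ×ˢ (univ : Set ℝ)
            · simp [indicator_of_mem hp]
            · simp [indicator_of_notMem hp]
          rw [abs_of_nonneg ha]
          nlinarith [sq_nonneg ((K ×ˢ (univ : Set ℝ)).indicator (fun _ ↦ max B 0) p - |v p|), sq_abs (v p)]
      exact (hI2.add hvT).add (hIv.const_mul 2)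
    refine hdom.mono' ?_ ?_
    · have hwc : ContinuousOn (fun p : M × ℝ ↦ w p.2 p.1 ^ 2) ((univ : Set M) ×ˢ Ioo (0 : ℝ) T) :=
        (hws.continuousOn.mono (Set.prod_mono le_rfl fun s hs ↦ by
          simp only [mem_Iio, hbdef]; linarith [hs.2])).pow 2
      exact hwc.aestronglyMeasurable hmeasS
    · rw [hν, ae_restrict_iff' hmeasS]
      refine Eventually.of_forall fun p hp ↦ ?_
      have h1 := hWbd p hp
      rw [Real.norm_eq_abs] at h1
      rw [Real.norm_eq_abs, abs_pow, hwdef]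
      simp only
      have h2 : |W p.2 p.1 + v (p.1, p.2)| ≤ |W p.2 p.1| + |v p| := by
        simpa using abs_add_le (W p.2 p.1) (v (p.1, p.2))
      have h3 : 0 ≤ |W p.2 p.1| := abs_nonneg _
      have h4 : 0 ≤ |v p| := abs_nonneg _
      calc |W p.2 p.1 + v (p.1, p.2)| ^ 2 ≤ (|W p.2 p.1| + |v p|) ^ 2 :=
            pow_le_pow_left₀ (abs_nonneg _) h2 2
        _ ≤ ((K ×ˢ (univ : Set ℝ)).indicator (fun _ ↦ max B 0) p + |v p|) ^ 2 := by
            apply pow_le_pow_left₀ (by positivity)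
            linarith
        _ = ((K ×ˢ (univ : Set ℝ)).indicator (fun _ ↦ max B 0) p) ^ 2 + v p ^ 2 +
              2 * (((K ×ˢ (univ : Set ℝ)).indicator (fun _ ↦ max B 0) p) * |v p|) := by
            rw [add_sq, sq_abs]; ring


/-- **The linear heat Cauchy problem with compactly supported datum on a complete manifold with Laplacian
cut-offs**: for `Q ≥ 1` smooth on `M × ℝ`, `w₀ ∈ C_c^∞(M)` and `T > 0` there is `w`, smooth on `M × O`
(`O ⊇ [0, T]` open), with `w(0) = w₀`, `∂ₛw = Δ_g w − Qw` on `[0, T]` (two-sided `deriv`) and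
`w ∈ L²(M × (0, T), V_g ⊗ ds)` — the flat corrector `exists_flatCorrector_of_hasCompactSupport` fed into
`exists_linearHeat_forcedData_noncompact`. [cite: Treves1975, §41, Thm. 40.1] -/
theorem exists_linearHeat_cauchy_noncompact (hg : g.IsRiemannian) {η : ℕ → M → ℝ} {C : ℝ}
    (hη : IsLaplacianCutoff g η C) {Q : ℝ → M → ℝ}
    (hQ : ContMDiff ((𝓡 n).prod 𝓘(ℝ, ℝ)) 𝓘(ℝ, ℝ) ∞ (fun p : M × ℝ ↦ Q p.2 p.1)) (hQ1 : ∀ s x, 1 ≤ Q s x)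
    {w₀ : M → ℝ} (hw₀ : ContMDiff (𝓡 n) 𝓘(ℝ, ℝ) ∞ w₀) (hw₀c : HasCompactSupport w₀) {T : ℝ} (hT : 0 < T) :
    ∃ (O : Set ℝ) (w : ℝ → M → ℝ), IsOpen O ∧ Icc 0 T ⊆ O ∧
      ContMDiffOn ((𝓡 n).prod 𝓘(ℝ, ℝ)) 𝓘(ℝ, ℝ) ∞ (fun p : M × ℝ ↦ w p.2 p.1) (univ ×ˢ O) ∧
      (∀ x, w 0 x = w₀ x) ∧
      (∀ s ∈ Icc 0 T, ∀ x, deriv (fun r ↦ w r x) s = g.dalembertian (w s) x - Q s x * w s x) ∧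
      Integrable (fun p : M × ℝ ↦ w p.2 p.1 ^ 2)
        ((g.riemVolume.prod (volume : Measure ℝ)).restrict (univ ×ˢ Ioo 0 T)) := by
  obtain ⟨W, G, K, hK, hW, hG, hW0, hWK, hGK, hWG1, hG0, hGW⟩ :=
    exists_flatCorrector_of_hasCompactSupport g hQ hw₀ hw₀c
  obtain ⟨O, w, hO, hTO, hws, hw0, hweq, hwL2⟩ := exists_linearHeat_forcedData_noncompact hg hη hQ hQ1 hK hW
    hG hWK hGK hWG1 hG0 hGW hT
  exact ⟨O, w, hO, hTO, hws, fun x ↦ by rw [hw0 x, hW0], hweq, hwL2⟩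

end Cauchy

end Literature.Geometry.Riemannian

end
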